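import Mathlib.Analysis.PSeries
import Literature.Probability.LatticeModels.Sweep1
import Literature.Probability.LatticeModels.IsingTransport
import Literature.Probability.LatticeModels.CriticalCorrWellDefined
import Literature.Probability.LatticeModels.TwoPointSupNormMonotone
import Literature.Barriers.CriticalPhenomena.IsingTreeDiagramBoundGraph
import HarnessLib

/-!
# High-dimensional triviality, pointwise form: `U₄ ≡ 0` for scaling limits of the critical
# Ising correlators in `d ≥ 5` (crit-ising.S13) — discharge of
# `limitConnectedFour_eq_zero_of_hasPointwiseScalingLimit`

Topic `Probability/LatticeModels`; family `crit-ising` (crit-ising.S13). Theorem-only file (no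
definitions, no named facts) proving the named fact
`Literature.Probability.LatticeModels.limitConnectedFour_eq_zero_of_hasPointwiseScalingLimit` of
`Sweep1.lean` (`limitConnectedFour_eq_zero_of_hasPointwiseScalingLimit_holds`, last section):
for the nearest-neighbour Ising model on `ℤ^d`, `d ≥ 5`, if the critical correlators
`ρ(δ)^n ⟨∏ σ_{[xᵢ/δ]}⟩_{β_c}` have a pointwise scaling limit `S` (locally uniformly on
non-coincident configurations, `HasPointwiseScalingLimit`) with a non-degenerate two-point
function, then the connected four-point function of `S` vanishes,
`U₄^S(x₀, …, x₃) = 0` at all non-coincident `x`.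

## The printed argument (Aizenman 1982; Aizenman, CDM 2020, §8.1 and §10.1)

Aizenman, *A geometric perspective on the scaling limits of critical Ising and `φ⁴_d` models*
(CDM 2020, arXiv:2112.04248; pages of the arXiv text): Lemma 8.1 / eq. (8.2), p. 25 — "For the
Ising model on any finite graph, at `h = 0` and `β ≥ 0` …
`|U₄(x₁,…,x₄)| ≤ 2 Σ_u ⟨σ_uσ_{x₁}⟩⟨σ_uσ_{x₂}⟩⟨σ_uσ_{x₃}⟩⟨σ_uσ_{x₄}⟩`" (the tree diagram bound
of Aizenman, CMP 86 (1982)); eq. (8.4), p. 26 — the infrared upper bound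
`⟨σ_xσ_y⟩_β ≤ C|x-y|^{2-d}`, `β ≤ β_c`; §10.1, p. 31, eqs. (10.1)–(10.2) — "for quadruples of
points at mutual distances of order `L`, in lattice units, the sum in the tree diagram bound
(8.2) contributes a factor `L^d` while the summand has two extra correlation function factors
`S₂(·,·)` … each `S₂` factor being of order `1/L^{d-2+η}`", whence
`|U₄|/S₄ ≤ C L^d / L^{2(d-2+η)} = C / L^{d-4+2η}`, "which for `d > 4` vanishes in the limit
`L → ∞`", the dimensional analysis relying "on the non-perturbative fact (implied by a reflection
positivity argument) that in this model `η ≥ 0`" (§10.1 (ii), p. 32).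

## What is formalised

With `yᵢ = [xᵢ/δ]` and `G(v) = ⟨σ₀σ_v⟩⁺_{β_c} = criticalTwoPoint d v`:

* §A — dictionary: `criticalCorr d 2 ![a, b] = G(b - a)` (translation invariance of the plus
  state, `plusPair_eq_twoPointPlus_sub`), symmetry, `0 ≤ G ≤ 1`, `|criticalCorr| ≤ 1`, and the
  infrared bound at `β_c` in integer-power form (`criticalTwoPoint_bounds_holds`,
  Duminil-Copin 2019 Thm. 4.8: `G(v) ≤ C‖v‖_∞^{-(d-2)}`).
* §B — the tree diagram bound for the critical state in infinite volume (`abs_criticalU4_le`):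
  the finite-graph theorem `Literature.Barriers.CriticalPhenomena.treeDiagramBound_holds`
  transported to boxes (inside the proof; cf. `treeDiagramBound_freeFinset`) and passed to the limit along the
  free-boundary box expectations, which converge to the critical state
  (`criticalCorr_wellDefined_holds`), the right side dominated through
  `⟨σ_uσ_y⟩^∅_Λ ≤ ⟨σ₀σ_{y-u}⟩^∅_{β_c} = G(y-u)`.
* §C — lattice sums: `Σ_{‖v‖_∞ ≤ n} ‖v‖_∞^{-(d-2)} ≲ n²`, summability of `‖u‖_∞^{-(2d-4)}` for
  `d ≥ 5`, tails.
* §D, §E, §G — floor geometry of `[·/δ]` and the two consequences of the scaling-limit hypothesis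
  that the proof consumes: uniform boundedness of `ρ(δ)²⟨σ_{[z₀/δ]}σ_{[z₁/δ]}⟩` on compact sets
  of non-coincident pairs (`exists_eventually_rescaled_two_le`), and the lower bound on the
  renormalisation `ρ(δ)^{-2} ≤ K δ^{d-2}` forced by `S₂ > 0` and the infrared bound
  (`exists_eventually_inv_sq_rho_le`) — the formal counterpart of "`η ≥ 0`".
* §F — the three regions of the tree diagram sum (`sum_box_prod_four_le`), for a general
  `0 ≤ G ≤ 1` with the infrared bound and the Messager–Miracle-Solé comparison
  `‖y‖_∞ ≥ d‖x‖_∞ ⇒ G(y) ≤ G(x)` (`twoPointPlus_le_of_mul_supNorm_le`): near a marked point one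
  factor is summed with the infrared bound and three are `≤ m`; in the bulk all four are `≤ m`;
  far away two factors carry the infrared bound and two are `≤ m` by monotonicity.
* §H — the discharge: `ρ⁴ U₄^{lat}(y) → U₄^S(x)` by the hypothesis at `n = 4, 2`, while
  `ρ⁴ |U₄^{lat}(y)| ≤ c₁δ^{d-2} + c₂δ^{d-4} + c₃·(tail of Σ‖u‖^{4-2d} beyond B/δ) → 0`.

## Design notes

* **No lower bound on the two-point function is used.** The docstring of the named fact mentions
  the lower bound `⟨σ₀σ_x⟩_{β_c} ≳ ‖x‖^{2-d}` of Duminil-Copin–Panis (2024) "to control the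
  renormalisation"; Aizenman's dimension count needs only `η ≥ 0`, i.e. the infrared *upper*
  bound, once the two-point factors at macroscopic distances are bounded through the scaling
  hypothesis itself (with `m = M ρ^{-2}`) rather than through the infrared bound. The statement
  is proved exactly as vendored (it is not mis-stated); its hypothesis `ρ > 0` is not needed.
* The Messager–Miracle-Solé step replaces the survey's standing assumption (10.1)(i) ("the
  two-point function is of comparable values for pairs of sites at similar distances") in the far
  region, where uniform convergence on compacts is unavailable.
* Constants in the final assembly are introduced as opaque variables with defining equations
  (never local definitions), so that no definitional unfolding is triggered by the arithmetic
  normalisers.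

## References

* M. Aizenman, *Geometric analysis of `φ⁴` fields and Ising models I–II*, Comm. Math. Phys. 86
  (1982) 1–48 [AizenmanCMP1982] (paywalled, not re-read; locators through the CDM survey).
* J. Fröhlich, Nucl. Phys. B 200 (1982) 281–296 [FrohlichTrivialityNPB1982].
* M. Aizenman, CDM 2020 (arXiv:2112.04248), Lemma 8.1, eqs. (8.2), (8.4), (8.5), §10.1
  eqs. (10.1)–(10.2) [AizenmanCDM2020] (read: pp. 25–26, 31–32 of the arXiv text).
* M. Aizenman, H. Duminil-Copin, Ann. Math. 194 (2021), §1.3 [AizenmanDuminilCopinAnnals2021].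
* H. Duminil-Copin, *Lectures on the Ising and Potts models*, Thm. 4.8 [DuminilCopin2019].

## Mathlib

`TendstoLocallyUniformlyOn` (`tendstoLocallyUniformlyOn_iff_forall_isCompact`,
`TendstoLocallyUniformlyOn.tendsto_at`), `Metric.tendstoUniformlyOn_iff`, `Nat.floor`,
`Real.summable_one_div_nat_pow`, `tendsto_inv_nhdsGT_zero`, `tendsto_nat_floor_atTop`,
`squeeze_zero_norm'`, `tendsto_nhds_unique`, `PiLp`/`WithLp` coordinates, `isCompact_iUnion`,
`Finset.inf'`. No definitions are introduced. Two short lattice lemmas (shell decomposition of a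
box, summability from shell bounds) and the transport of the finite-graph tree diagram bound to a
box are local copies of lemmas of `HighDimTrivialityUniformProofs` / `HighDimTrivialityTreeBound`,
so that this file stays off the import closure of the high-dimensional-triviality stack.
-/

noncomputable section

open MeasureTheory Filter Topology Finset
open Literature.Probability.LatticeModels Literature.Probability.Percolation

namespace Literature.Probability.LatticeModels

variable {d : ℕ}

/-! ### A. The critical two-point dictionary -/

/-- `criticalCorr d 2 ![a, b] = ⟨σ_a σ_b⟩⁺_{β_c} = ⟨σ₀ σ_{b-a}⟩⁺_{β_c}` (translation invariance of
the plus state, `plusPair_eq_twoPointPlus_sub`). [folklore] -/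
theorem criticalCorr_two_pair (a b : Site d) :
    criticalCorr d 2 ![a, b] = criticalTwoPoint d (b - a) := by
  have h1 : criticalCorr d 2 ![a, b] = plusPair d (criticalBeta d) a b := by
    change plusExpect d (criticalBeta d) 0 (spinMonomial ![a, b]) =
      plusExpect d (criticalBeta d) 0 (spinPair a b)
    congr 1
    funext s
    simp [spinMonomial, spinPair, Fin.prod_univ_two]
  rw [h1, plusPair_eq_twoPointPlus_sub (criticalBeta_nonneg d)]
  rfl

/-- Symmetry of the pair correlator in its two arguments. [folklore] -/
theorem criticalCorr_two_pair_comm (a b : Site d) :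
    criticalCorr d 2 ![a, b] = criticalCorr d 2 ![b, a] := by
  change plusExpect d (criticalBeta d) 0 (spinMonomial ![a, b]) =
    plusExpect d (criticalBeta d) 0 (spinMonomial ![b, a])
  congr 1
  funext s
  simp [spinMonomial, Fin.prod_univ_two, mul_comm]

/-- `⟨σ₀σ_{-v}⟩⁺_{β_c} = ⟨σ₀σ_v⟩⁺_{β_c}`. [folklore] -/
theorem criticalTwoPoint_neg (v : Site d) : criticalTwoPoint d (-v) = criticalTwoPoint d v := by
  have h := criticalCorr_two_pair (d := d) v 0
  rw [criticalCorr_two_pair_comm, criticalCorr_two_pair, sub_zero, zero_sub] at h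
  exact h.symm

/-- `⟨σ₀σ_{a-b}⟩⁺_{β_c} = ⟨σ₀σ_{b-a}⟩⁺_{β_c}`. [folklore] -/
theorem criticalTwoPoint_sub_comm (a b : Site d) :
    criticalTwoPoint d (a - b) = criticalTwoPoint d (b - a) := by
  rw [← neg_sub, criticalTwoPoint_neg]

/-- `0 ≤ ⟨σ₀σ_v⟩⁺_{β_c}` (Griffiths). [folklore] -/
theorem criticalTwoPoint_nonneg' (v : Site d) : 0 ≤ criticalTwoPoint d v :=
  twoPointPlus_nonneg_of_gks (criticalBeta_nonneg d) v

/-- `⟨σ₀σ_v⟩⁺_{β_c} ≤ 1`. [folklore] -/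
theorem criticalTwoPoint_le_one' (v : Site d) : criticalTwoPoint d v ≤ 1 :=
  twoPointPlus_le_one_of_nonneg (criticalBeta_nonneg d) v

/-- `⟨σ₀σ₀⟩⁺_{β_c} = 1`. [folklore] -/
theorem criticalTwoPoint_zero' : criticalTwoPoint d 0 = 1 :=
  twoPointPlus_zero d _

/-- `|criticalCorr d n y| ≤ 1` for `d ≥ 3` (box limit of finite-volume expectations of spin
products). [folklore] -/
theorem abs_criticalCorr_le_one (hd : 3 ≤ d) (n : ℕ) (y : Fin n → Site d) :
    |criticalCorr d n y| ≤ 1 := by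
  classical
  have h := criticalCorr_wellDefined_holds (d := d) hd n y .plus (by simp)
  obtain ⟨A, hA⟩ := exists_spinMonomial_eq_spinProduct y
  refine le_of_tendsto' h.abs fun L => ?_
  rw [hA]
  exact abs_isingCorr_le_one (zdGraph d) (box d L) (criticalBeta d) 0 .plus A

/-- **The infrared bound at `β_c` in integer-power form**: for `d ≥ 3` there is `C ≥ 0` with
`⟨σ₀σ_v⟩⁺_{β_c} ≤ C ‖v‖_∞^{-(d-2)}` for all `v ≠ 0` (`criticalTwoPoint_bounds_holds`,
Duminil-Copin 2019 Thm. 4.8 / Fröhlich–Simon–Spencer 1976). [cite: DuminilCopin2019, Thm. 4.8, §4.4] -/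
theorem exists_criticalTwoPoint_le_inv_pow (hd : 3 ≤ d) :
    ∃ C : ℝ, 0 ≤ C ∧ ∀ v : Site d, v ≠ 0 →
      criticalTwoPoint d v ≤ C * ((Site.supNorm v : ℝ) ^ (d - 2))⁻¹ := by
  obtain ⟨c, C, -, h⟩ := criticalTwoPoint_bounds_holds (d := d) hd
  refine ⟨max C 0, le_max_right _ _, fun v hv => ?_⟩
  have h2 := (h v hv).2
  have hn : (Site.supNorm v : ℝ) ^ (-((d : ℝ) - 2)) = ((Site.supNorm v : ℝ) ^ (d - 2))⁻¹ := by
    rw [Real.rpow_neg (Nat.cast_nonneg _), show ((d : ℝ) - 2) = ((d - 2 : ℕ) : ℝ) by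
      rw [Nat.cast_sub (by omega : 2 ≤ d)]; norm_num, Real.rpow_natCast]
  rw [Site.norm_eq_supNorm, hn] at h2
  refine h2.trans (mul_le_mul_of_nonneg_right (le_max_left _ _) ?_)
  positivity

/-! ### B₀. Transport along the subtype embedding of a finite volume -/

/-- `univ.map (subtype embedding of Λ) = Λ`. [folklore] -/
private theorem univ_map_embeddingSubtype_eq (Λ : Finset (Site d)) :
    (Finset.univ : Finset ↥Λ).map (Function.Embedding.subtype fun x => x ∈ Λ) = Λ := by
  rw [Finset.univ_eq_attach, Finset.attach_map_val]

/-! ### B. The tree diagram bound for the critical state in infinite volume -/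

/-- **Aizenman's tree diagram bound for the critical correlators on `ℤ^d`, `d ≥ 3`**: if the
finite partial sums `∑_{u ∈ Λ_L} ∏ⱼ ⟨σ₀σ_{yⱼ-u}⟩⁺_{β_c}` are bounded by `B`, then
`|U₄(y)| ≤ 2B`, where `U₄(y) = ⟨σ_{y₀}σ_{y₁}σ_{y₂}σ_{y₃}⟩_{β_c} - ∑_{pairings} ⟨σσ⟩⟨σσ⟩`
is written with `criticalCorr d 4` and `criticalCorr d 2`. Limit `Λ_L ↑ ℤ^d` of the
finite-graph bound (`treeDiagramBound_holds`, transported to boxes inside the proof) along the free-boundary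
box expectations, which converge to the critical state (`criticalCorr_wellDefined_holds`); the
right side is dominated through `⟨σ_uσ_y⟩^∅_Λ ≤ ⟨σ₀σ_{y-u}⟩^∅_{β_c} = ⟨σ₀σ_{y-u}⟩⁺_{β_c}`.
[cite: AizenmanCDM2020, Lemma 8.1 and eq. (8.2) (p. 25 of arXiv:2112.04248)] [cite: AizenmanCMP1982, tree diagram bound (restated as CDM 2020, Lemma 8.1)] -/
theorem abs_criticalU4_le (hd : 3 ≤ d) (y : Fin 4 → Site d) {B : ℝ}
    (hB : ∀ L : ℕ, ∑ u ∈ box d L, ∏ j, criticalTwoPoint d (y j - u) ≤ B) :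
    |criticalCorr d 4 y - (criticalCorr d 2 ![y 0, y 1] * criticalCorr d 2 ![y 2, y 3]
        + criticalCorr d 2 ![y 0, y 2] * criticalCorr d 2 ![y 1, y 3]
        + criticalCorr d 2 ![y 0, y 3] * criticalCorr d 2 ![y 1, y 2])| ≤ 2 * B := by
  classical
  set β := criticalBeta d with hβdef
  have hβ : 0 ≤ β := criticalBeta_nonneg d
  have hgks : ∀ {Λ A : Finset (Site d)} {β h : ℝ} {bc : BoundaryCondition (Site d)},
      gks_one (zdGraph d) (Λ := Λ) (A := A) (β := β) (h := h) (bc := bc) :=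
    GKSInequalities.gks_one_holds (zdGraph d)
  have hlim : hasBoxLimit_isingCorr_free d := hasBoxLimit_isingCorr_free_holds
  have hmono : isingCorr_free_mono_volume (d := d) := isingCorr_free_mono_volume_holds
  have htr : isingTwoPoint_free_translate (d := d) := isingTwoPoint_free_translate_holds
  -- the tree diagram bound in a box: the finite-graph theorem `treeDiagramBound_holds`
  -- transported to the free state of `Λ ⊆ ℤ^d` (the Ising model of the induced graph on `↥Λ`,
  -- `isingExpect_free_map` along the subtype embedding); this is `treeDiagramBound_freeFinset` of
  -- `HighDimTrivialityUniformProofs`, re-proved here to keep this file off that import closure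
  have htrans : ∀ (Λ : Finset (Site d)) (x : Fin 4 → Site d), (∀ i, x i ∈ Λ) →
      |connectedFour (isingMeasure (zdGraph d) Λ β 0 .free) spinAt x| ≤
        2 * ∑ u ∈ Λ, ∏ j, isingTwoPoint (zdGraph d) Λ β 0 .free u (x j) := by
    intro Λ x hx
    classical
    set φ : ↥Λ ↪ Site d := Function.Embedding.subtype fun x => x ∈ Λ with hφ
    set yv : Fin 4 → ↥Λ := fun i => ⟨x i, hx i⟩ with hyv
    have key := Literature.Barriers.CriticalPhenomena.treeDiagramBound_holds (↥Λ)
      ((zdGraph d).comap φ) β hβ yv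
    -- transport of expectations of measurable observables
    have hexp : ∀ {f : SpinConfig (Site d) → ℝ}, Measurable f →
        isingExpect (zdGraph d) Λ β 0 .free f =
          isingExpect ((zdGraph d).comap φ) Finset.univ β 0 .free
            (fun τ => f (SpinConfig.extendAlong φ τ)) := by
      intro f hf
      have h1 := isingExpect_free_map (G := (zdGraph d).comap φ) (G' := zdGraph d) φ
        (Λ := Finset.univ) (fun a _ b _ => Iff.rfl) β 0 hf
      rw [univ_map_embeddingSubtype_eq] at h1
      exact h1
    -- transport of the four-point function
    have hn : nPoint (isingMeasure (zdGraph d) Λ β 0 .free) spinAt x =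
        nPoint (isingMeasure ((zdGraph d).comap φ) Finset.univ β 0 .free) spinAt yv := by
      change isingExpect (zdGraph d) Λ β 0 .free (fun σ => ∏ i, spinAt (x i) σ) =
        isingExpect ((zdGraph d).comap φ) Finset.univ β 0 .free (fun τ => ∏ i, spinAt (yv i) τ)
      rw [hexp (Finset.measurable_prod _ fun i _ => measurable_spinAt _)]
      congr 1
      funext τ
      refine Finset.prod_congr rfl fun i _ => ?_
      exact spinAt_extendAlong φ τ (yv i)
    -- transport of the two-point functions
    have h2 : ∀ a b : ↥Λ, isingTwoPoint (zdGraph d) Λ β 0 .free (a : Site d) b =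
        isingTwoPoint ((zdGraph d).comap φ) Finset.univ β 0 .free a b := by
      intro a b
      have := isingTwoPoint_free_map (G := (zdGraph d).comap φ) (G' := zdGraph d) φ
        (Λ := Finset.univ) (fun a _ b _ => Iff.rfl) β 0 a b
      rw [univ_map_embeddingSubtype_eq] at this
      exact this
    have hc : connectedFour (isingMeasure (zdGraph d) Λ β 0 .free) spinAt x =
        connectedFour (isingMeasure ((zdGraph d).comap φ) Finset.univ β 0 .free) spinAt yv := by
      simp only [connectedFour, hn]
      have : ∀ i j, twoPoint (isingMeasure (zdGraph d) Λ β 0 .free) spinAt (x i) (x j) =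
          twoPoint (isingMeasure ((zdGraph d).comap φ) Finset.univ β 0 .free) spinAt (yv i) (yv j) :=
        fun i j => h2 (yv i) (yv j)
      simp only [this]
    rw [hc]
    refine key.trans (le_of_eq ?_)
    congr 1
    rw [← Finset.sum_coe_sort Λ]
    refine Finset.sum_congr rfl fun u _ => Finset.prod_congr rfl fun j _ => ?_
    exact (h2 u (yv j)).symm
  -- convergence of the finite-volume free expectations to the critical state
  have hconv_n : ∀ {n : ℕ} (z : Fin n → Site d), Tendsto
      (fun L : ℕ => nPoint (isingMeasure (zdGraph d) (box d L) β 0 .free) spinAt z) atTop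
      (𝓝 (criticalCorr d n z)) := fun z =>
    criticalCorr_wellDefined_holds (d := d) hd _ z .free (by simp)
  have hconv_2 : ∀ a b : Site d, Tendsto
      (fun L : ℕ => twoPoint (isingMeasure (zdGraph d) (box d L) β 0 .free) spinAt a b) atTop
      (𝓝 (criticalCorr d 2 ![a, b])) := by
    intro a b
    have h := hconv_n ![a, b]
    simp only [nPoint, Fin.prod_univ_two, Matrix.cons_val_zero, Matrix.cons_val_one] at h
    exact h
  have hconv : Tendsto (fun L : ℕ => connectedFour (isingMeasure (zdGraph d) (box d L) β 0 .free)
      spinAt y) atTop (𝓝 (criticalCorr d 4 y - (criticalCorr d 2 ![y 0, y 1] *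
        criticalCorr d 2 ![y 2, y 3] + criticalCorr d 2 ![y 0, y 2] * criticalCorr d 2 ![y 1, y 3]
        + criticalCorr d 2 ![y 0, y 3] * criticalCorr d 2 ![y 1, y 2]))) := by
    have h := (((hconv_n y).sub ((hconv_2 (y 0) (y 1)).mul (hconv_2 (y 2) (y 3)))).sub
      ((hconv_2 (y 0) (y 2)).mul (hconv_2 (y 1) (y 3)))).sub
      ((hconv_2 (y 0) (y 3)).mul (hconv_2 (y 1) (y 2)))
    have he : criticalCorr d 4 y - (criticalCorr d 2 ![y 0, y 1] *
        criticalCorr d 2 ![y 2, y 3] + criticalCorr d 2 ![y 0, y 2] * criticalCorr d 2 ![y 1, y 3]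
        + criticalCorr d 2 ![y 0, y 3] * criticalCorr d 2 ![y 1, y 2]) =
        criticalCorr d 4 y - criticalCorr d 2 ![y 0, y 1] * criticalCorr d 2 ![y 2, y 3]
        - criticalCorr d 2 ![y 0, y 2] * criticalCorr d 2 ![y 1, y 3]
        - criticalCorr d 2 ![y 0, y 3] * criticalCorr d 2 ![y 1, y 2] := by ring
    rw [he]
    exact h
  -- eventually all `y i` lie in the box
  obtain ⟨L₀, hL₀⟩ := exists_forall_subset_box d (Finset.univ.image y)
  have hybox : ∀ L, L₀ ≤ L → ∀ i, y i ∈ box d L := fun L hL i =>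
    hL₀ L hL (Finset.mem_image_of_mem y (Finset.mem_univ i))
  -- the finite-volume bound
  have hfin : ∀ L, L₀ ≤ L →
      |connectedFour (isingMeasure (zdGraph d) (box d L) β 0 .free) spinAt y| ≤ 2 * B := by
    intro L hL
    refine (htrans (box d L) y (hybox L hL)).trans ?_
    refine mul_le_mul_of_nonneg_left ?_ zero_le_two
    refine le_trans ?_ (hB L)
    refine Finset.sum_le_sum fun u hu => ?_
    refine Finset.prod_le_prod (fun j _ => isingTwoPoint_free_nonneg hgks hβ hu (hybox L hL j))
      fun j _ => ?_
    have h1 := isingTwoPoint_free_le_twoPointFree_sub hmono hlim htr hβ hu (hybox L hL j)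
    rwa [twoPointFree_criticalBeta_eq_criticalTwoPoint criticalCorr_wellDefined_holds hd] at h1
  refine le_of_tendsto hconv.abs ?_
  filter_upwards [eventually_ge_atTop L₀] with L hL
  exact hfin L hL


/-! ### C. Lattice sums -/

/-- A box is the disjoint union of the spheres it contains:
`∑_{x ∈ Λ_N} f(x) = ∑_{m ≤ N} ∑_{‖x‖_∞ = m} f(x)` (local copy of the shell decomposition of
`HighDimTrivialityUniformProofs`, kept here to avoid that import closure). [folklore] -/
private theorem sum_box_eq_sum_range_shellSum (f : Site d → ℝ) (N : ℕ) :
    ∑ x ∈ box d N, f x = ∑ m ∈ Finset.range (N + 1), ∑ x ∈ sphere d m, f x := by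
  rw [← Finset.sum_fiberwise_of_maps_to (g := Site.supNorm) (t := Finset.range (N + 1))
    (fun x hx => Finset.mem_range.2 (Nat.lt_succ_of_le (mem_box_iff_supNorm_le.1 hx)))]
  refine Finset.sum_congr rfl fun m hm => Finset.sum_congr ?_ fun _ _ => rfl
  ext x
  simp only [Finset.mem_filter, mem_box_iff_supNorm_le, mem_sphere]
  constructor
  · rintro ⟨-, h⟩; exact h
  · intro h; exact ⟨by rw [h]; exact Nat.lt_succ_iff.1 (Finset.mem_range.1 hm), h⟩

/-- Summability on `ℤ^d` from a bound by a function of the sup norm whose shell sums are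
summable: `0 ≤ f(x) ≤ a(‖x‖_∞)` and `∑_m |∂Λ_m| a(m) < ∞` (local copy, as above). [folklore] -/
private theorem summable_of_sphere_shell_bound {f : Site d → ℝ} (hf : ∀ x, 0 ≤ f x) {a : ℕ → ℝ}
    (hfa : ∀ x, f x ≤ a (Site.supNorm x))
    (ha : Summable fun m => (#(sphere d m) : ℝ) * a m) : Summable f := by
  have ha0 : ∀ m, 0 ≤ (#(sphere d m) : ℝ) * a m := by
    intro m
    rcases (sphere d m).eq_empty_or_nonempty with h | ⟨x, hx⟩
    · simp [h]
    · exact mul_nonneg (Nat.cast_nonneg _) ((hf x).trans (by rw [← mem_sphere.1 hx]; exact hfa x))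
  refine summable_of_sum_le (c := ∑' m, (#(sphere d m) : ℝ) * a m) (fun x => hf x) fun s => ?_
  obtain ⟨N, hN⟩ : ∃ N : ℕ, s ⊆ box d N :=
    ⟨s.sup Site.supNorm, fun x hx => mem_box_iff_supNorm_le.2 (Finset.le_sup (f := Site.supNorm) hx)⟩
  refine (Finset.sum_le_sum_of_subset_of_nonneg hN fun x _ _ => hf x).trans ?_
  rw [sum_box_eq_sum_range_shellSum]
  calc ∑ m ∈ Finset.range (N + 1), ∑ x ∈ sphere d m, f x
      ≤ ∑ m ∈ Finset.range (N + 1), (#(sphere d m) : ℝ) * a m := by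
        refine Finset.sum_le_sum fun m _ => ?_
        calc ∑ x ∈ sphere d m, f x ≤ ∑ x ∈ sphere d m, a m :=
              Finset.sum_le_sum fun x hx => by rw [← mem_sphere.1 hx]; exact hfa x
          _ = (#(sphere d m) : ℝ) * a m := by rw [Finset.sum_const, nsmul_eq_mul]
    _ ≤ ∑' m, (#(sphere d m) : ℝ) * a m := ha.sum_le_tsum _ fun m _ => ha0 m

/-- `∑_{v ∈ Λ_n} ‖v‖_∞^{-(d-2)} ≤ 2d·3^{d-1}·(n+1)²` (shell count `|∂Λ_m| ≤ 2d(2m+1)^{d-1}`; the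
term `v = 0` is `0⁻¹ = 0`). [folklore] -/
theorem sum_box_inv_pow_supNorm_le (hd : 3 ≤ d) (n : ℕ) :
    ∑ v ∈ box d n, ((Site.supNorm v : ℝ) ^ (d - 2))⁻¹ ≤
      2 * d * 3 ^ (d - 1) * ((n : ℝ) + 1) ^ 2 := by
  rw [sum_box_eq_sum_range_shellSum]
  have hshell : ∀ m ∈ Finset.range (n + 1),
      ∑ v ∈ sphere d m, ((Site.supNorm v : ℝ) ^ (d - 2))⁻¹ ≤ 2 * d * 3 ^ (d - 1) * (m : ℝ) := by
    intro m _
    have hconst : ∑ v ∈ sphere d m, ((Site.supNorm v : ℝ) ^ (d - 2))⁻¹ =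
        (#(sphere d m) : ℝ) * (((m : ℝ)) ^ (d - 2))⁻¹ := by
      rw [Finset.sum_congr rfl fun v hv => by rw [mem_sphere.1 hv], Finset.sum_const, nsmul_eq_mul]
    rw [hconst]
    rcases m with _ | k
    · simp [zero_pow (by omega : d - 2 ≠ 0)]
    · have hcard := card_sphere_succ_le (d := d) k
      have hk1 : (0 : ℝ) < (k : ℝ) + 1 := by positivity
      have h3 : (2 * (k : ℝ) + 3) ^ (d - 1) ≤ (3 : ℝ) ^ (d - 1) * ((k : ℝ) + 1) ^ (d - 1) := by
        rw [← mul_pow]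
        exact pow_le_pow_left₀ (by positivity) (by linarith) _
      have hsplit : ((k : ℝ) + 1) ^ (d - 1) = ((k : ℝ) + 1) ^ (d - 2) * ((k : ℝ) + 1) := by
        rw [← pow_succ]; congr 1; omega
      push_cast
      calc (#(sphere d (k + 1)) : ℝ) * (((k : ℝ) + 1) ^ (d - 2))⁻¹
          ≤ (2 * d * (2 * (k : ℝ) + 3) ^ (d - 1)) * (((k : ℝ) + 1) ^ (d - 2))⁻¹ :=
            mul_le_mul_of_nonneg_right hcard (by positivity)
        _ ≤ (2 * d * ((3 : ℝ) ^ (d - 1) * ((k : ℝ) + 1) ^ (d - 1))) * (((k : ℝ) + 1) ^ (d - 2))⁻¹ := by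
            gcongr
        _ = 2 * d * 3 ^ (d - 1) * ((k : ℝ) + 1) := by
            rw [hsplit]
            have hne : ((k : ℝ) + 1) ^ (d - 2) ≠ 0 := pow_ne_zero _ hk1.ne'
            field_simp
  calc ∑ m ∈ Finset.range (n + 1), ∑ v ∈ sphere d m, ((Site.supNorm v : ℝ) ^ (d - 2))⁻¹
      ≤ ∑ m ∈ Finset.range (n + 1), 2 * d * 3 ^ (d - 1) * (m : ℝ) := Finset.sum_le_sum hshell
    _ ≤ ∑ _m ∈ Finset.range (n + 1), 2 * d * 3 ^ (d - 1) * (n : ℝ) := by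
        refine Finset.sum_le_sum fun m hm => ?_
        have : (m : ℝ) ≤ n := by exact_mod_cast Nat.lt_succ_iff.1 (Finset.mem_range.1 hm)
        gcongr
    _ = 2 * d * 3 ^ (d - 1) * (((n : ℝ) + 1) * n) := by
        rw [Finset.sum_const, Finset.card_range, nsmul_eq_mul]; push_cast; ring
    _ ≤ 2 * d * 3 ^ (d - 1) * ((n : ℝ) + 1) ^ 2 := by
        gcongr
        nlinarith

/-- For `d ≥ 5`, `u ↦ ‖u‖_∞^{-(2d-4)}` is summable on `ℤ^d` (`|∂Λ_m| m^{-(2d-4)} ≲ m^{-(d-3)}`).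
[folklore] -/
theorem summable_inv_pow_supNorm (hd : 5 ≤ d) :
    Summable fun u : Site d => ((Site.supNorm u : ℝ) ^ (2 * d - 4))⁻¹ := by
  refine summable_of_sphere_shell_bound (fun u => by positivity) (a := fun m => ((m : ℝ) ^ (2 * d - 4))⁻¹)
    (fun u => le_rfl) ?_
  have hg : Summable fun m : ℕ => 2 * (d : ℝ) * 3 ^ (d - 1) * (1 / (m : ℝ) ^ (d - 3)) :=
    (Real.summable_one_div_nat_pow.2 (by omega : 1 < d - 3)).mul_left _
  refine Summable.of_nonneg_of_le (fun m => by positivity) (fun m => ?_) hg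
  rcases m with _ | k
  · simp [zero_pow (by omega : 2 * d - 4 ≠ 0), zero_pow (by omega : d - 3 ≠ 0)]
  · have hcard := card_sphere_succ_le (d := d) k
    have hk1 : (0 : ℝ) < (k : ℝ) + 1 := by positivity
    have h3 : (2 * (k : ℝ) + 3) ^ (d - 1) ≤ (3 : ℝ) ^ (d - 1) * ((k : ℝ) + 1) ^ (d - 1) := by
      rw [← mul_pow]
      exact pow_le_pow_left₀ (by positivity) (by linarith) _
    have hsplit : ((k : ℝ) + 1) ^ (2 * d - 4) = ((k : ℝ) + 1) ^ (d - 1) * ((k : ℝ) + 1) ^ (d - 3) := by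
      rw [← pow_add]; congr 1; omega
    push_cast
    calc (#(sphere d (k + 1)) : ℝ) * (((k : ℝ) + 1) ^ (2 * d - 4))⁻¹
        ≤ (2 * d * (2 * (k : ℝ) + 3) ^ (d - 1)) * (((k : ℝ) + 1) ^ (2 * d - 4))⁻¹ :=
          mul_le_mul_of_nonneg_right hcard (by positivity)
      _ ≤ (2 * d * ((3 : ℝ) ^ (d - 1) * ((k : ℝ) + 1) ^ (d - 1))) * (((k : ℝ) + 1) ^ (2 * d - 4))⁻¹ := by
          gcongr
      _ = 2 * (d : ℝ) * 3 ^ (d - 1) * (1 / ((k : ℝ) + 1) ^ (d - 3)) := by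
          rw [hsplit]
          have hne : ((k : ℝ) + 1) ^ (d - 1) ≠ 0 := pow_ne_zero _ hk1.ne'
          have hne' : ((k : ℝ) + 1) ^ (d - 3) ≠ 0 := pow_ne_zero _ hk1.ne'
          field_simp

/-- Partial sums over boxes converge to the full lattice sum, so the remainders
`∑_x S(x) - ∑_{x ∈ Λ_n} S(x)` tend to zero. [folklore] -/
theorem tendsto_tsum_sub_sum_box_atTop {S : Site d → ℝ} (hsum : Summable S) :
    Tendsto (fun n => (∑' x, S x) - ∑ x ∈ box d n, S x) atTop (𝓝 0) := by
  have hbox : Tendsto (box d) atTop atTop :=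
    tendsto_atTop_finset_of_monotone (box_mono d) fun x =>
      ⟨Site.supNorm x, mem_box_iff_supNorm_le.2 le_rfl⟩
  have hpart : Tendsto (fun n : ℕ => ∑ x ∈ box d n, S x) atTop (𝓝 (∑' x, S x)) :=
    hsum.hasSum.comp hbox
  have h := (tendsto_const_nhds (x := ∑' x, S x)).sub hpart
  rwa [sub_self] at h

/-- A finite sum of a non-negative summable function over sites of sup norm `> n` inside a box
is at most the remainder `∑_x S(x) - ∑_{x ∈ Λ_n} S(x)`. [folklore] -/
theorem sum_filter_lt_supNorm_le_tsum_sub {S : Site d → ℝ} (hS : ∀ x, 0 ≤ S x)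
    (hsum : Summable S) (L n : ℕ) :
    ∑ u ∈ (box d L).filter (fun u => n < Site.supNorm u), S u ≤
      (∑' x, S x) - ∑ x ∈ box d n, S x := by
  classical
  set s := (box d L).filter (fun u => n < Site.supNorm u) with hs
  have hdisj : Disjoint s (box d n) := by
    rw [Finset.disjoint_left]
    intro u hu hun
    have h1 := (Finset.mem_filter.1 hu).2
    have h2 := mem_box_iff_supNorm_le.1 hun
    omega
  have h := hsum.sum_le_tsum (s ∪ box d n) fun u _ => hS u
  rw [Finset.sum_union hdisj] at h
  linarith

/-! ### D. Lattice approximations -/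

/-- `[δu/δ] = u` for a lattice site `u` and `δ > 0`. [folklore] -/
theorem latticeApprox_smul_siteVec {δ : ℝ} (hδ : 0 < δ) (u : Site d) :
    latticeApprox δ (δ • siteVec u) = u := by
  funext k
  rw [latticeApprox_apply, PiLp.smul_apply, siteVec_apply, smul_eq_mul,
    mul_div_cancel_left₀ _ hδ.ne', Int.floor_intCast]

/-- The floor error: `|δ [p/δ]_k - p_k| ≤ δ` for `δ > 0`. [folklore] -/
theorem abs_mul_latticeApprox_sub_le {δ : ℝ} (hδ : 0 < δ) (p : EuclideanSpace ℝ (Fin d))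
    (k : Fin d) : |δ * (latticeApprox δ p k : ℝ) - p k| ≤ δ := by
  rw [latticeApprox_apply]
  have h1 : (⌊p k / δ⌋ : ℝ) ≤ p k / δ := Int.floor_le _
  have h2 : p k / δ < ⌊p k / δ⌋ + 1 := Int.lt_floor_add_one _
  have h1' : δ * (⌊p k / δ⌋ : ℝ) ≤ p k := by
    have := mul_le_mul_of_nonneg_left h1 hδ.le
    rwa [mul_div_cancel₀ _ hδ.ne'] at this
  have h2' : p k < δ * (⌊p k / δ⌋ : ℝ) + δ := by
    have := mul_lt_mul_of_pos_left h2 hδ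
    rwa [mul_div_cancel₀ _ hδ.ne', mul_add, mul_one] at this
  rw [abs_le]
  constructor <;> linarith

/-- `‖[p/δ]‖_∞ ≤ ‖p‖_∞ / δ + 1` for `δ > 0`. [folklore] -/
theorem supNorm_latticeApprox_le {δ : ℝ} (hδ : 0 < δ) (p : EuclideanSpace ℝ (Fin d)) :
    (Site.supNorm (latticeApprox δ p) : ℝ) ≤ ‖WithLp.ofLp p‖ / δ + 1 := by
  rw [← Site.norm_eq_supNorm, pi_norm_le_iff_of_nonneg (by positivity)]
  intro k
  rw [latticeApprox_apply, Int.norm_eq_abs]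
  have hk : |p k| ≤ ‖WithLp.ofLp p‖ := by
    have := norm_le_pi_norm (WithLp.ofLp p) k
    rwa [Real.norm_eq_abs] at this
  have h1 : (⌊p k / δ⌋ : ℝ) ≤ p k / δ := Int.floor_le _
  have h2 : p k / δ < ⌊p k / δ⌋ + 1 := Int.lt_floor_add_one _
  have h3 : |p k / δ| ≤ ‖WithLp.ofLp p‖ / δ := by
    rw [abs_div, abs_of_pos hδ]
    exact div_le_div_of_nonneg_right hk hδ.le
  rw [abs_le]
  have := abs_le.1 h3
  constructor <;> linarith

/-- Coordinates of lattice approximations are `δ`-close after rescaling: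
`|δ([p/δ]_k - [q/δ]_k) - (p_k - q_k)| ≤ 2δ`. [folklore] -/
theorem abs_mul_sub_latticeApprox_sub_le {δ : ℝ} (hδ : 0 < δ) (p q : EuclideanSpace ℝ (Fin d))
    (k : Fin d) :
    |δ * ((latticeApprox δ p k : ℝ) - (latticeApprox δ q k : ℝ)) - (p k - q k)| ≤ 2 * δ := by
  have h1 := abs_mul_latticeApprox_sub_le hδ p k
  have h2 := abs_mul_latticeApprox_sub_le hδ q k
  calc |δ * ((latticeApprox δ p k : ℝ) - (latticeApprox δ q k : ℝ)) - (p k - q k)|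
      = |(δ * (latticeApprox δ p k : ℝ) - p k) - (δ * (latticeApprox δ q k : ℝ) - q k)| := by
        ring_nf
    _ ≤ |δ * (latticeApprox δ p k : ℝ) - p k| + |δ * (latticeApprox δ q k : ℝ) - q k| :=
        abs_sub _ _
    _ ≤ 2 * δ := by linarith

/-- A coordinate bounds the sup norm from below: `|v_k| ≤ ‖v‖_∞`. [folklore] -/
theorem abs_coord_le_supNorm (v : Site d) (k : Fin d) : |(v k : ℝ)| ≤ (Site.supNorm v : ℝ) := by
  rw [← Site.norm_eq_supNorm, ← Int.norm_eq_abs]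
  exact norm_le_pi_norm v k


/-! ### E. Consequences of the pointwise scaling-limit hypothesis -/

/-- On a `Fin 2`-indexed configuration, `fun k => [z_k/δ]` is the pair `![[z₀/δ], [z₁/δ]]`.
[folklore] -/
theorem latticeApprox_comp_two (δ : ℝ) (z : Fin 2 → EuclideanSpace ℝ (Fin d)) :
    (fun k => latticeApprox δ (z k)) = ![latticeApprox δ (z 0), latticeApprox δ (z 1)] := by
  funext k
  fin_cases k <;> rfl

/-- **Uniform boundedness of the rescaled pair correlators on compacts.** If the critical
correlators have a pointwise scaling limit with renormalisation `ρ`, then on every compact set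
`K` of non-coincident pairs the rescaled pair correlators `ρ(δ)² ⟨σ_{[z₀/δ]}σ_{[z₁/δ]}⟩_{β_c}`
are bounded, uniformly in `z ∈ K`, for all small `δ > 0` (uniform convergence on compacts and
`|⟨σσ⟩| ≤ 1`). [folklore] -/
theorem exists_eventually_rescaled_two_le (hd : 3 ≤ d) {ρ : ℝ → ℝ} {S : CorrFamily d}
    (hlim : HasPointwiseScalingLimit (criticalCorr d) ρ S)
    {K : Set (Fin 2 → EuclideanSpace ℝ (Fin d))} (hK : IsCompact K) (hKs : K ⊆ NonCoincident d 2) :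
    ∃ M : ℝ, ∀ᶠ δ in 𝓝[>] (0 : ℝ), ∀ z ∈ K,
      ρ δ ^ 2 * criticalCorr d 2 (fun k => latticeApprox δ (z k)) ≤ M := by
  have hU : TendstoUniformlyOn (rescaledCorrelator (criticalCorr d) ρ 2) (S 2) (𝓝[>] 0) K :=
    (tendstoLocallyUniformlyOn_iff_forall_isCompact (isOpen_nonCoincident d 2)).1 (hlim 2) K hKs hK
  have h1 : ∀ᶠ δ in 𝓝[>] (0 : ℝ), ∀ z ∈ K,
      dist (S 2 z) (rescaledCorrelator (criticalCorr d) ρ 2 δ z) < 1 :=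
    Metric.tendstoUniformlyOn_iff.1 hU 1 one_pos
  obtain ⟨δ₁, hδ₁⟩ := h1.exists
  refine ⟨ρ δ₁ ^ 2 + 2, h1.mono fun δ hδ z hz => ?_⟩
  have hb : rescaledCorrelator (criticalCorr d) ρ 2 δ₁ z ≤ ρ δ₁ ^ 2 := by
    rw [rescaledCorrelator_apply]
    calc ρ δ₁ ^ 2 * criticalCorr d 2 (fun i => latticeApprox δ₁ (z i))
        ≤ ρ δ₁ ^ 2 * 1 := mul_le_mul_of_nonneg_left
          ((le_abs_self _).trans (abs_criticalCorr_le_one hd _ _)) (sq_nonneg _)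
      _ = ρ δ₁ ^ 2 := mul_one _
  have e1 := abs_sub_lt_iff.1 (Real.dist_eq _ _ ▸ hδ₁ z hz)
  have e2 := abs_sub_lt_iff.1 (Real.dist_eq _ _ ▸ hδ z hz)
  have : rescaledCorrelator (criticalCorr d) ρ 2 δ z =
      ρ δ ^ 2 * criticalCorr d 2 (fun k => latticeApprox δ (z k)) := rfl
  linarith [e1.1, e1.2, e2.1, e2.2]

/-- **The infrared bound forces `ρ(δ) ≳ δ^{-(d-2)/2}`.** If the rescaled pair correlator at one
non-coincident pair `z₀` converges to a positive value, then `ρ(δ)^{-2} ≤ K δ^{d-2}` for all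
small `δ > 0` (`⟨σ_{[z₀₀/δ]}σ_{[z₀₁/δ]}⟩_{β_c} ≤ C (‖z₀₁ - z₀₀‖_∞/δ)^{-(d-2)}` by the infrared bound).
[cite: AizenmanCDM2020, §10.1 eq. (10.1) with remark (ii), p. 32 (η ≥ 0 from the infrared bound (8.4))] -/
theorem exists_eventually_inv_sq_rho_le (hd : 3 ≤ d) {ρ : ℝ → ℝ} {S : CorrFamily d}
    (hlim : HasPointwiseScalingLimit (criticalCorr d) ρ S)
    {z₀ : Fin 2 → EuclideanSpace ℝ (Fin d)} (hz₀ : z₀ ∈ NonCoincident d 2) (hpos : 0 < S 2 z₀) :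
    ∃ K : ℝ, ∀ᶠ δ in 𝓝[>] (0 : ℝ), 0 < ρ δ ^ 2 ∧ (ρ δ ^ 2)⁻¹ ≤ K * δ ^ (d - 2) := by
  obtain ⟨C, hC0, hIR⟩ := exists_criticalTwoPoint_le_inv_pow hd
  have hinj : Function.Injective z₀ := hz₀
  have hne : z₀ 0 ≠ z₀ 1 := fun h => absurd (hinj h) (by decide)
  obtain ⟨k, hk⟩ : ∃ k, z₀ 0 k ≠ z₀ 1 k := by
    by_contra h
    push Not at h
    exact hne (PiLp.ext h)
  set t : ℝ := |z₀ 1 k - z₀ 0 k| with ht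
  have htpos : 0 < t := abs_pos.2 (sub_ne_zero.2 (Ne.symm hk))
  have hconv := (hlim 2).tendsto_at hz₀
  have hev1 : ∀ᶠ δ in 𝓝[>] (0 : ℝ), S 2 z₀ / 2 < rescaledCorrelator (criticalCorr d) ρ 2 δ z₀ :=
    (tendsto_order.1 hconv).1 _ (half_lt_self hpos)
  have hev2 : ∀ᶠ δ in 𝓝[>] (0 : ℝ), δ < t / 4 :=
    (eventually_lt_nhds (by positivity : (0 : ℝ) < t / 4)).filter_mono nhdsWithin_le_nhds
  have hev3 : ∀ᶠ δ in 𝓝[>] (0 : ℝ), 0 < δ := eventually_mem_nhdsWithin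
  refine ⟨2 / S 2 z₀ * (C * (2 / t) ^ (d - 2)), ?_⟩
  filter_upwards [hev1, hev2, hev3] with δ h1 h2 hδ
  set a := latticeApprox δ (z₀ 0) with ha
  set b := latticeApprox δ (z₀ 1) with hb
  have hresc : rescaledCorrelator (criticalCorr d) ρ 2 δ z₀ = ρ δ ^ 2 * criticalTwoPoint d (b - a) := by
    rw [rescaledCorrelator_apply, latticeApprox_comp_two, criticalCorr_two_pair]
  -- the lattice distance between `a` and `b` is at least `t / (2δ)`
  have hcoord : t / (2 * δ) ≤ |((b - a) k : ℝ)| := by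
    have h := abs_mul_sub_latticeApprox_sub_le hδ (z₀ 1) (z₀ 0) k
    have hcast : (((b - a) k : ℤ) : ℝ) = (b k : ℝ) - (a k : ℝ) := by push_cast [Pi.sub_apply]; ring
    rw [hcast]
    have h' : t - 2 * δ ≤ δ * |(b k : ℝ) - (a k : ℝ)| := by
      have := abs_sub_abs_le_abs_sub (z₀ 1 k - z₀ 0 k) (δ * ((b k : ℝ) - (a k : ℝ)))
      rw [abs_sub_comm] at h
      rw [abs_mul, abs_of_pos hδ] at this
      linarith
    rw [div_le_iff₀ (by positivity)]
    nlinarith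
  have hsup : t / (2 * δ) ≤ (Site.supNorm (b - a) : ℝ) := hcoord.trans (abs_coord_le_supNorm _ k)
  have htδ : 0 < t / (2 * δ) := by positivity
  have hba : b - a ≠ 0 := by
    intro h0
    rw [h0, Site.supNorm_eq_zero_iff.2 rfl, Nat.cast_zero] at hsup
    linarith
  have hG : criticalTwoPoint d (b - a) ≤ C * (2 / t) ^ (d - 2) * δ ^ (d - 2) := by
    refine (hIR _ hba).trans ?_
    have hinv : ((Site.supNorm (b - a) : ℝ) ^ (d - 2))⁻¹ ≤ ((t / (2 * δ)) ^ (d - 2))⁻¹ :=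
      inv_anti₀ (pow_pos htδ _) (pow_le_pow_left₀ htδ.le hsup _)
    calc C * ((Site.supNorm (b - a) : ℝ) ^ (d - 2))⁻¹ ≤ C * ((t / (2 * δ)) ^ (d - 2))⁻¹ :=
          mul_le_mul_of_nonneg_left hinv hC0
      _ = C * (2 / t) ^ (d - 2) * δ ^ (d - 2) := by
          rw [← inv_pow, inv_div, show 2 * δ / t = 2 / t * δ by ring, mul_pow]; ring
  have hkey : S 2 z₀ / 2 < ρ δ ^ 2 * (C * (2 / t) ^ (d - 2) * δ ^ (d - 2)) := by
    rw [hresc] at h1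
    exact h1.trans_le (mul_le_mul_of_nonneg_left hG (sq_nonneg _))
  have hX : 0 ≤ C * (2 / t) ^ (d - 2) * δ ^ (d - 2) := by positivity
  have hρ : 0 < ρ δ ^ 2 := by
    rcases (sq_nonneg (ρ δ)).lt_or_eq with h | h
    · exact h
    · rw [← h, zero_mul] at hkey; linarith
  refine ⟨hρ, ?_⟩
  rw [inv_le_iff_one_le_mul₀ hρ]
  have hS2 : 0 < S 2 z₀ / 2 := half_pos hpos
  calc (1 : ℝ) ≤ ρ δ ^ 2 * (C * (2 / t) ^ (d - 2) * δ ^ (d - 2)) / (S 2 z₀ / 2) :=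
        (one_le_div hS2).2 hkey.le
    _ = ρ δ ^ 2 * (2 / S 2 z₀ * (C * (2 / t) ^ (d - 2)) * δ ^ (d - 2)) := by
        field_simp
    _ = 2 / S 2 z₀ * (C * (2 / t) ^ (d - 2)) * δ ^ (d - 2) * ρ δ ^ 2 := by ring


/-! ### F. The three regions of the tree diagram sum -/

/-- The near region around one point: `∑_{u : ‖u - yᵢ‖_∞ ≤ n} G(yᵢ - u) ≤ 1 + C·2d3^{d-1}(n+1)²`
for `0 ≤ G ≤ 1` obeying the infrared bound `G(v) ≤ C‖v‖_∞^{-(d-2)}` (`v ≠ 0`). [folklore] -/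
theorem sum_filter_near_le (hd : 3 ≤ d) {G : Site d → ℝ} (hG0 : ∀ v, 0 ≤ G v)
    (hG1 : ∀ v, G v ≤ 1) {C : ℝ} (hC : 0 ≤ C)
    (hIR : ∀ v, v ≠ 0 → G v ≤ C * ((Site.supNorm v : ℝ) ^ (d - 2))⁻¹)
    (s : Finset (Site d)) (a : Site d) (n : ℕ) (hs : ∀ u ∈ s, Site.supNorm (u - a) ≤ n) :
    ∑ u ∈ s, G (a - u) ≤ 1 + C * (2 * d * 3 ^ (d - 1) * ((n : ℝ) + 1) ^ 2) := by
  classical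
  have h1 : ∑ u ∈ s, G (a - u) = ∑ v ∈ s.image (· - a), G (-v) := by
    rw [Finset.sum_image (fun u _ v _ h => sub_left_injective h)]
    refine Finset.sum_congr rfl fun u _ => ?_
    rw [neg_sub]
  have h2 : s.image (· - a) ⊆ box d n := by
    intro v hv
    obtain ⟨u, hu, rfl⟩ := Finset.mem_image.1 hv
    exact mem_box_iff_supNorm_le.2 (hs u hu)
  have h3 : ∀ v : Site d, G (-v) ≤ (if v = 0 then 1 else 0) + C * ((Site.supNorm v : ℝ) ^ (d - 2))⁻¹ := by
    intro v
    by_cases hv : v = 0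
    · subst hv
      rw [if_pos rfl, neg_zero]
      have : 0 ≤ C * ((Site.supNorm (0 : Site d) : ℝ) ^ (d - 2))⁻¹ := by positivity
      linarith [hG1 (0 : Site d)]
    · rw [if_neg hv, zero_add]
      have h := hIR (-v) (neg_ne_zero.2 hv)
      rwa [Site.supNorm_neg] at h
  calc ∑ u ∈ s, G (a - u) = ∑ v ∈ s.image (· - a), G (-v) := h1
    _ ≤ ∑ v ∈ box d n, G (-v) := Finset.sum_le_sum_of_subset_of_nonneg h2 fun v _ _ => hG0 _
    _ ≤ ∑ v ∈ box d n, ((if v = 0 then 1 else 0) + C * ((Site.supNorm v : ℝ) ^ (d - 2))⁻¹) :=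
        Finset.sum_le_sum fun v _ => h3 v
    _ = 1 + C * ∑ v ∈ box d n, ((Site.supNorm v : ℝ) ^ (d - 2))⁻¹ := by
        rw [Finset.sum_add_distrib, Finset.sum_ite_eq' (box d n) (0 : Site d) (fun _ => (1 : ℝ)),
          if_pos (zero_mem_box d n), Finset.mul_sum]
    _ ≤ 1 + C * (2 * d * 3 ^ (d - 1) * ((n : ℝ) + 1) ^ 2) := by
        gcongr
        exact sum_box_inv_pow_supNorm_le hd n

/-- **The three regions of the tree diagram sum** (the dimension count behind the `d > 4`
triviality theorem of Aizenman 1982 / Fröhlich 1982, for a general non-negative `G ≤ 1` obeying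
the infrared bound and the Messager–Miracle-Solé comparison). For `u` within `n_A` of some
`yᵢ` one factor is controlled by the infrared bound and the other three by `m`; for `u` in the
bulk all four factors are `≤ m`; far away two factors are controlled by the infrared bound and two
by monotonicity. [cite: AizenmanCDM2020, §10.1 eq. (10.2) (the dimension count L^d / L^{2(d-2+η)})] [cite: AizenmanDuminilCopinAnnals2021, arXiv:1912.07973 §1.3 (tree diagram bound, infrared bound, U₄ = O(L^{4-d}))] -/
theorem sum_box_prod_four_le (hd : 3 ≤ d) {G : Site d → ℝ} (hG0 : ∀ v, 0 ≤ G v)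
    (hG1 : ∀ v, G v ≤ 1) {C : ℝ} (hC : 0 ≤ C)
    (hIR : ∀ v, v ≠ 0 → G v ≤ C * ((Site.supNorm v : ℝ) ^ (d - 2))⁻¹)
    (hsum : Summable fun u : Site d => ((Site.supNorm u : ℝ) ^ (2 * d - 4))⁻¹)
    (y : Fin 4 → Site d) (nA nC : ℕ) (w : Site d) {m : ℝ} (hm : 0 ≤ m)
    (hA : ∀ i j, i ≠ j → ∀ u, Site.supNorm (u - y i) ≤ nA → G (y j - u) ≤ m)
    (hB : ∀ u, Site.supNorm u ≤ nC → (∀ i, nA < Site.supNorm (u - y i)) → ∀ i, G (y i - u) ≤ m)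
    (hw : G w ≤ m) (hMMS : ∀ v, d * Site.supNorm w ≤ Site.supNorm v → G v ≤ G w)
    (hC1 : ∀ u, nC < Site.supNorm u → ∀ i, d * Site.supNorm w ≤ Site.supNorm (y i - u))
    (hC2 : ∀ u, nC < Site.supNorm u → ∀ i, Site.supNorm u ≤ 2 * Site.supNorm (y i - u))
    (L : ℕ) :
    ∑ u ∈ box d L, ∏ j, G (y j - u) ≤
      4 * (m ^ 3 * (1 + C * (2 * d * 3 ^ (d - 1) * ((nA : ℝ) + 1) ^ 2)))
      + (#(box d nC) : ℝ) * m ^ 4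
      + C ^ 2 * 4 ^ (d - 2) * m ^ 2 *
          ((∑' u : Site d, ((Site.supNorm u : ℝ) ^ (2 * d - 4))⁻¹)
            - ∑ u ∈ box d nC, ((Site.supNorm u : ℝ) ^ (2 * d - 4))⁻¹) := by
  classical
  set T₂ : Site d → ℝ := fun u => ((Site.supNorm u : ℝ) ^ (2 * d - 4))⁻¹ with hT₂
  set cA : ℝ := 1 + C * (2 * d * 3 ^ (d - 1) * ((nA : ℝ) + 1) ^ 2) with hcA
  have hT₂0 : ∀ u, 0 ≤ T₂ u := fun u => by positivity
  have hcA0 : 0 ≤ cA := by positivity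
  -- the three majorants
  set FA : Site d → ℝ := fun u =>
    ∑ i, if Site.supNorm (u - y i) ≤ nA then G (y i - u) * m ^ 3 else 0 with hFA
  set FB : Site d → ℝ := fun u =>
    if Site.supNorm u ≤ nC ∧ ∀ i, nA < Site.supNorm (u - y i) then m ^ 4 else 0 with hFB
  set FC : Site d → ℝ := fun u =>
    if nC < Site.supNorm u then C ^ 2 * 4 ^ (d - 2) * m ^ 2 * T₂ u else 0 with hFC
  have hFA0 : ∀ u, 0 ≤ FA u := fun u => Finset.sum_nonneg fun i _ => by
    split_ifs
    · exact mul_nonneg (hG0 _) (pow_nonneg hm 3)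
    · exact le_rfl
  have hFB0 : ∀ u, 0 ≤ FB u := fun u => by
    simp only [hFB]
    split_ifs
    · exact pow_nonneg hm 4
    · exact le_rfl
  have hFC0 : ∀ u, 0 ≤ FC u := fun u => by
    simp only [hFC]
    split_ifs
    · exact mul_nonneg (by positivity) (hT₂0 u)
    · exact le_rfl
  -- pointwise domination
  have hpt : ∀ u, ∏ j, G (y j - u) ≤ FA u + FB u + FC u := by
    intro u
    by_cases hAu : ∃ i, Site.supNorm (u - y i) ≤ nA
    · obtain ⟨i, hi⟩ := hAu
      have h1 : ∏ j, G (y j - u) ≤ G (y i - u) * m ^ 3 := by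
        rw [← Finset.mul_prod_erase _ _ (Finset.mem_univ i)]
        refine mul_le_mul_of_nonneg_left ?_ (hG0 _)
        calc ∏ j ∈ univ.erase i, G (y j - u) ≤ ∏ _j ∈ univ.erase i, m :=
              Finset.prod_le_prod (fun j _ => hG0 _) fun j hj =>
                hA i j (Finset.ne_of_mem_erase hj).symm u hi
          _ = m ^ 3 := by
              rw [Finset.prod_const, Finset.card_erase_of_mem (Finset.mem_univ i), Finset.card_fin]
      have h2 : G (y i - u) * m ^ 3 ≤ FA u := by
        have := Finset.single_le_sum
          (f := fun i => if Site.supNorm (u - y i) ≤ nA then G (y i - u) * m ^ 3 else 0)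
          (fun j _ => by
            show (0 : ℝ) ≤ if Site.supNorm (u - y j) ≤ nA then G (y j - u) * m ^ 3 else 0
            split_ifs
            · exact mul_nonneg (hG0 _) (pow_nonneg hm 3)
            · exact le_rfl) (Finset.mem_univ i)
        simp only [if_pos hi] at this
        exact this
      linarith [hFB0 u, hFC0 u]
    · push Not at hAu
      by_cases hCu : nC < Site.supNorm u
      · -- the far region
        have hu1 : 1 ≤ Site.supNorm u := by omega
        have hyu : ∀ i, y i - u ≠ 0 := fun i h0 => by
          have := hC2 u hCu i
          rw [h0, Site.supNorm_eq_zero_iff.2 rfl] at this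
          omega
        have hP : ∀ i, G (y i - u) ≤ C * 2 ^ (d - 2) * ((Site.supNorm u : ℝ) ^ (d - 2))⁻¹ := by
          intro i
          refine (hIR _ (hyu i)).trans ?_
          have hs : (Site.supNorm u : ℝ) / 2 ≤ Site.supNorm (y i - u) := by
            have : (Site.supNorm u : ℝ) ≤ 2 * Site.supNorm (y i - u) := by exact_mod_cast hC2 u hCu i
            linarith
          have hspos : (0 : ℝ) < Site.supNorm u / 2 := by
            have : (1 : ℝ) ≤ Site.supNorm u := by exact_mod_cast hu1
            linarith
          calc C * ((Site.supNorm (y i - u) : ℝ) ^ (d - 2))⁻¹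
              ≤ C * (((Site.supNorm u : ℝ) / 2) ^ (d - 2))⁻¹ :=
                mul_le_mul_of_nonneg_left
                  (inv_anti₀ (pow_pos hspos _) (pow_le_pow_left₀ hspos.le hs _)) hC
            _ = C * 2 ^ (d - 2) * ((Site.supNorm u : ℝ) ^ (d - 2))⁻¹ := by
                rw [div_pow, inv_div, div_eq_mul_inv]; ring
        have hM : ∀ i, G (y i - u) ≤ m := fun i => (hMMS _ (hC1 u hCu i)).trans hw
        set P : ℝ := C * 2 ^ (d - 2) * ((Site.supNorm u : ℝ) ^ (d - 2))⁻¹ with hP'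
        have hPnn : 0 ≤ P := by positivity
        have h1 : ∏ j, G (y j - u) ≤ P * P * m * m := by
          rw [Fin.prod_univ_four]
          exact mul_le_mul (mul_le_mul (mul_le_mul (hP 0) (hP 1) (hG0 _) hPnn) (hM 2) (hG0 _)
            (by positivity)) (hM 3) (hG0 _) (by positivity)
        have h2 : P * P * m * m = FC u := by
          simp only [hFC, if_pos hCu, hP', hT₂]
          rw [show 2 * d - 4 = (d - 2) * 2 by omega, pow_mul,
            show (4 : ℝ) ^ (d - 2) = (2 ^ (d - 2)) ^ 2 by rw [← pow_mul, mul_comm, pow_mul]; norm_num]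
          field_simp
        linarith [hFA0 u, hFB0 u]
      · -- the bulk
        push Not at hCu
        have h1 : ∏ j, G (y j - u) ≤ m ^ 4 := by
          calc ∏ j, G (y j - u) ≤ ∏ _j : Fin 4, m :=
                Finset.prod_le_prod (fun j _ => hG0 _) fun j _ => hB u hCu hAu j
            _ = m ^ 4 := by rw [Finset.prod_const, Finset.card_fin]
        have h2 : FB u = m ^ 4 := by simp only [hFB, if_pos (And.intro hCu hAu)]
        linarith [hFA0 u, hFC0 u]
  -- summing the three majorants
  have hSA : ∑ u ∈ box d L, FA u ≤ 4 * (m ^ 3 * cA) := by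
    simp only [hFA]
    rw [Finset.sum_comm]
    calc ∑ i : Fin 4, ∑ u ∈ box d L, (if Site.supNorm (u - y i) ≤ nA then G (y i - u) * m ^ 3 else 0)
        ≤ ∑ _i : Fin 4, m ^ 3 * cA := by
          refine Finset.sum_le_sum fun i _ => ?_
          rw [← Finset.sum_filter, ← Finset.sum_mul]
          calc (∑ u ∈ (box d L).filter (fun u => Site.supNorm (u - y i) ≤ nA), G (y i - u)) * m ^ 3
              ≤ cA * m ^ 3 := by
                refine mul_le_mul_of_nonneg_right ?_ (pow_nonneg hm 3)
                exact sum_filter_near_le hd hG0 hG1 hC hIR _ (y i) nA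
                  (fun u hu => (Finset.mem_filter.1 hu).2)
            _ = m ^ 3 * cA := mul_comm _ _
      _ = 4 * (m ^ 3 * cA) := by rw [Finset.sum_const, Finset.card_fin]; simp [nsmul_eq_mul]
  have hSB : ∑ u ∈ box d L, FB u ≤ (#(box d nC) : ℝ) * m ^ 4 := by
    simp only [hFB]
    rw [← Finset.sum_filter, Finset.sum_const, nsmul_eq_mul]
    refine mul_le_mul_of_nonneg_right ?_ (pow_nonneg hm 4)
    have hsub : (box d L).filter (fun u => Site.supNorm u ≤ nC ∧ ∀ i, nA < Site.supNorm (u - y i))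
        ⊆ box d nC := fun u hu => mem_box_iff_supNorm_le.2 (Finset.mem_filter.1 hu).2.1
    exact_mod_cast Finset.card_le_card hsub
  have hSC : ∑ u ∈ box d L, FC u ≤
      C ^ 2 * 4 ^ (d - 2) * m ^ 2 * ((∑' u, T₂ u) - ∑ u ∈ box d nC, T₂ u) := by
    simp only [hFC]
    rw [← Finset.sum_filter, ← Finset.mul_sum]
    refine mul_le_mul_of_nonneg_left ?_ (by positivity)
    exact sum_filter_lt_supNorm_le_tsum_sub hT₂0 hsum L nC
  calc ∑ u ∈ box d L, ∏ j, G (y j - u) ≤ ∑ u ∈ box d L, (FA u + FB u + FC u) :=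
        Finset.sum_le_sum fun u _ => hpt u
    _ = ∑ u ∈ box d L, FA u + ∑ u ∈ box d L, FB u + ∑ u ∈ box d L, FC u := by
        rw [Finset.sum_add_distrib, Finset.sum_add_distrib]
    _ ≤ 4 * (m ^ 3 * cA) + (#(box d nC) : ℝ) * m ^ 4
        + C ^ 2 * 4 ^ (d - 2) * m ^ 2 * ((∑' u, T₂ u) - ∑ u ∈ box d nC, T₂ u) :=
          add_le_add_three hSA hSB hSC


/-! ### G. Geometry of the rescaled lattice around the marked points -/

/-- A pair of distinct points is a non-coincident configuration. [folklore] -/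
theorem pair_mem_nonCoincident {p q : EuclideanSpace ℝ (Fin d)} (h : p ≠ q) :
    (![p, q] : Fin 2 → EuclideanSpace ℝ (Fin d)) ∈ NonCoincident d 2 := by
  rw [mem_nonCoincident]
  intro i j hij
  fin_cases i <;> fin_cases j
  · rfl
  · exact absurd hij h
  · exact absurd hij.symm h
  · rfl

/-- Continuity of `w ↦ ![c, c' + w]` (as a map from `ℝ^d` with the sup norm). [folklore] -/
theorem continuous_pair_add_toLp (c c' : EuclideanSpace ℝ (Fin d)) :
    Continuous fun w : Fin d → ℝ =>
      (![c, c' + WithLp.toLp 2 w] : Fin 2 → EuclideanSpace ℝ (Fin d)) :=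
  continuous_const.matrixVecCons
    ((continuous_const.add (PiLp.continuous_toLp 2 _)).matrixVecCons continuous_const)

/-- The rescaled site `δu` is within `2a` (sup norm) of `xᵢ` when `u` is within `⌊a/δ⌋` lattice
steps of `[xᵢ/δ]` and `δ ≤ a`. [folklore] -/
theorem norm_rescaled_sub_le_of_supNorm_le {δ a : ℝ} (hδ : 0 < δ) (hδa : δ ≤ a)
    (p : EuclideanSpace ℝ (Fin d)) (u : Site d)
    (hu : Site.supNorm (u - latticeApprox δ p) ≤ ⌊a / δ⌋₊) :
    ‖WithLp.ofLp (δ • siteVec u) - WithLp.ofLp p‖ ≤ 2 * a := by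
  rw [pi_norm_le_iff_of_nonneg (by linarith)]
  intro k
  rw [Pi.sub_apply, Real.norm_eq_abs, WithLp.ofLp_smul, Pi.smul_apply, smul_eq_mul]
  change |δ * (u k : ℝ) - p k| ≤ 2 * a
  have h1 : |((u - latticeApprox δ p) k : ℝ)| ≤ (⌊a / δ⌋₊ : ℝ) :=
    (abs_coord_le_supNorm _ k).trans (by exact_mod_cast hu)
  have h2 : (⌊a / δ⌋₊ : ℝ) ≤ a / δ := Nat.floor_le (div_nonneg (hδ.le.trans hδa) hδ.le)
  have h3 := abs_mul_latticeApprox_sub_le hδ p k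
  have hcast : (((u - latticeApprox δ p) k : ℤ) : ℝ) = (u k : ℝ) - (latticeApprox δ p k : ℝ) := by
    push_cast [Pi.sub_apply]; ring
  rw [hcast] at h1
  have h4 : |δ * ((u k : ℝ) - (latticeApprox δ p k : ℝ))| ≤ a := by
    rw [abs_mul, abs_of_pos hδ]
    calc δ * |(u k : ℝ) - (latticeApprox δ p k : ℝ)| ≤ δ * (a / δ) :=
          mul_le_mul_of_nonneg_left (h1.trans h2) hδ.le
      _ = a := mul_div_cancel₀ _ hδ.ne'
  calc |δ * (u k : ℝ) - p k|
      = |δ * ((u k : ℝ) - (latticeApprox δ p k : ℝ)) + (δ * (latticeApprox δ p k : ℝ) - p k)| := by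
        ring_nf
    _ ≤ |δ * ((u k : ℝ) - (latticeApprox δ p k : ℝ))| + |δ * (latticeApprox δ p k : ℝ) - p k| :=
        abs_add_le _ _
    _ ≤ a + δ := add_le_add h4 h3
    _ ≤ 2 * a := by linarith

/-- The rescaled site `δu` is at least `a/2` (sup norm) away from `xᵢ` when `u` is more than
`⌊a/δ⌋` lattice steps from `[xᵢ/δ]` and `δ ≤ a/2` (`d ≥ 1`). [folklore] -/
theorem le_norm_rescaled_sub_of_lt_supNorm (hd : 1 ≤ d) {δ a : ℝ} (hδ : 0 < δ) (hδa : δ ≤ a / 2)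
    (p : EuclideanSpace ℝ (Fin d)) (u : Site d)
    (hu : ⌊a / δ⌋₊ < Site.supNorm (u - latticeApprox δ p)) :
    a / 2 ≤ ‖WithLp.ofLp (δ • siteVec u) - WithLp.ofLp p‖ := by
  have hne : (Finset.univ : Finset (Fin d)).Nonempty := ⟨⟨0, hd⟩, Finset.mem_univ _⟩
  obtain ⟨k, hk⟩ := Site.exists_natAbs_eq_supNorm hne (u - latticeApprox δ p)
  refine le_trans ?_ (norm_le_pi_norm _ k)
  rw [Pi.sub_apply, Real.norm_eq_abs, WithLp.ofLp_smul, Pi.smul_apply, smul_eq_mul]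
  change a / 2 ≤ |δ * (u k : ℝ) - p k|
  have h1 : a / δ < |((u - latticeApprox δ p) k : ℝ)| := by
    have h := Nat.lt_floor_add_one (a / δ)
    have h' : ((⌊a / δ⌋₊ + 1 : ℕ) : ℝ) ≤ (Site.supNorm (u - latticeApprox δ p) : ℝ) := by
      exact_mod_cast hu
    have h'' : (Site.supNorm (u - latticeApprox δ p) : ℝ) = |((u - latticeApprox δ p) k : ℝ)| := by
      rw [← hk, ← Int.cast_abs, ← Int.natCast_natAbs, Int.cast_natCast]
    push_cast at h'
    linarith
  have hcast : (((u - latticeApprox δ p) k : ℤ) : ℝ) = (u k : ℝ) - (latticeApprox δ p k : ℝ) := by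
    push_cast [Pi.sub_apply]; ring
  rw [hcast] at h1
  have h2 : a < |δ * ((u k : ℝ) - (latticeApprox δ p k : ℝ))| := by
    rw [abs_mul, abs_of_pos hδ]
    have := mul_lt_mul_of_pos_left h1 hδ
    rwa [mul_div_cancel₀ _ hδ.ne'] at this
  have h3 := abs_mul_latticeApprox_sub_le hδ p k
  have h4 : |δ * ((u k : ℝ) - (latticeApprox δ p k : ℝ))| ≤
      |δ * (u k : ℝ) - p k| + |δ * (latticeApprox δ p k : ℝ) - p k| := by
    calc |δ * ((u k : ℝ) - (latticeApprox δ p k : ℝ))|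
        = |(δ * (u k : ℝ) - p k) - (δ * (latticeApprox δ p k : ℝ) - p k)| := by ring_nf
      _ ≤ |δ * (u k : ℝ) - p k| + |δ * (latticeApprox δ p k : ℝ) - p k| := abs_sub _ _
  linarith

/-- `‖δu‖_∞ ≤ B` when `‖u‖_∞ ≤ ⌊B/δ⌋` (`δ > 0`, `B ≥ 0`). [folklore] -/
theorem norm_rescaled_le_of_supNorm_le {δ B : ℝ} (hδ : 0 < δ) (hB : 0 ≤ B) (u : Site d)
    (hu : Site.supNorm u ≤ ⌊B / δ⌋₊) : ‖WithLp.ofLp (δ • siteVec u)‖ ≤ B := by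
  rw [pi_norm_le_iff_of_nonneg hB]
  intro k
  rw [Real.norm_eq_abs, WithLp.ofLp_smul, Pi.smul_apply, smul_eq_mul]
  change |δ * (u k : ℝ)| ≤ B
  rw [abs_mul, abs_of_pos hδ]
  have h1 : |(u k : ℝ)| ≤ (⌊B / δ⌋₊ : ℝ) := (abs_coord_le_supNorm u k).trans (by exact_mod_cast hu)
  have h2 : (⌊B / δ⌋₊ : ℝ) ≤ B / δ := Nat.floor_le (by positivity)
  calc δ * |(u k : ℝ)| ≤ δ * (B / δ) := mul_le_mul_of_nonneg_left (h1.trans h2) hδ.le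
    _ = B := mul_div_cancel₀ _ hδ.ne'

/-- `x + (δu - x) = δu` in `ℝ^d`. [folklore] -/
theorem add_toLp_ofLp_sub (p : EuclideanSpace ℝ (Fin d)) (q : EuclideanSpace ℝ (Fin d)) :
    p + WithLp.toLp 2 (WithLp.ofLp q - WithLp.ofLp p) = q := by
  rw [← WithLp.ofLp_sub, WithLp.toLp_ofLp, add_sub_cancel]


/-! ### H. The discharge of crit-ising.S13 (pointwise form, `d ≥ 5`) -/

/-- **crit-ising.S13, pointwise form, proved: in `d ≥ 5` every pointwise scaling limit of the
critical Ising correlators with a non-degenerate two-point function has `U₄ ≡ 0`** (Aizenman,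
Comm. Math. Phys. 86 (1982) 1; Fröhlich, Nucl. Phys. B 200 (1982) 281; the argument as restated in
Aizenman, CDM 2020, §8.1 and §10.1). Discharge of the named fact
`limitConnectedFour_eq_zero_of_hasPointwiseScalingLimit` of `Sweep1.lean`.

Proof (Aizenman's dimension count, assembled from theorems of the tree): with
`yᵢ = [xᵢ/δ]`, `ρ(δ)⁴ U₄^{lat}(y) → U₄^S(x)` by the hypothesis at `n = 4` and `n = 2`; the
tree diagram bound (`treeDiagramBound_holds`, in infinite volume `abs_criticalU4_le`) gives
`|U₄^{lat}(y)| ≤ 2 ∑_u ∏ⱼ ⟨σ₀σ_{yⱼ-u}⟩_{β_c}`; the infrared bound `⟨σ₀σ_v⟩_{β_c} ≤ C‖v‖^{2-d}`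
(`criticalTwoPoint_bounds_holds`) and `S₂ > 0` force `ρ(δ)^{-2} ≲ δ^{d-2}`
(`exists_eventually_inv_sq_rho_le`); splitting the sum into the neighbourhoods of the `yᵢ`
(one infrared factor, three factors `≲ ρ^{-2}` by uniform convergence on compacts), the bulk
(four factors `≲ ρ^{-2}`) and the far region (two infrared factors, two factors `≲ ρ^{-2}` by the
Messager–Miracle-Solé comparison `twoPointPlus_le_of_mul_supNorm_le`)
(`sum_box_prod_four_le`) bounds `ρ⁴|U₄^{lat}|` by `O(δ^{d-4}) + o(1) → 0`. No lower bound on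
the two-point function is used. [cite: AizenmanCMP1982, d > 4 Gaussianity of scaling limits and the tree diagram bound (as restated in CDM 2020, §8.1)] [cite: FrohlichTrivialityNPB1982] [cite: AizenmanCDM2020, §8.1 Lemma 8.1, eqs. (8.2), (8.4), (8.5) (pp. 25–26) and §10.1 eqs. (10.1)–(10.2) (p. 31)] [cite: AizenmanDuminilCopinAnnals2021, arXiv:1912.07973 §1.3 (tree diagram bound, infrared bound, U₄ = O(L^{4-d}))] -/
theorem limitConnectedFour_eq_zero_of_hasPointwiseScalingLimit_holds :
    limitConnectedFour_eq_zero_of_hasPointwiseScalingLimit := by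
  intro d hd ρ S _hρ hlim hS₂ x hx
  classical
  have hd3 : 3 ≤ d := by omega
  have hd1 : 1 ≤ d := by omega
  have hinj : Function.Injective x := hx
  /- Step 1: the rescaled lattice `U₄` at `yᵢ = [xᵢ/δ]` converges to `limitConnectedFour S x`. -/
  set U : ℝ → ℝ := fun δ => ρ δ ^ 4 * (criticalCorr d 4 (fun i => latticeApprox δ (x i)) -
      (criticalCorr d 2 ![latticeApprox δ (x 0), latticeApprox δ (x 1)] *
          criticalCorr d 2 ![latticeApprox δ (x 2), latticeApprox δ (x 3)]
        + criticalCorr d 2 ![latticeApprox δ (x 0), latticeApprox δ (x 2)] *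
          criticalCorr d 2 ![latticeApprox δ (x 1), latticeApprox δ (x 3)]
        + criticalCorr d 2 ![latticeApprox δ (x 0), latticeApprox δ (x 3)] *
          criticalCorr d 2 ![latticeApprox δ (x 1), latticeApprox δ (x 2)])) with hU
  have hpair : ∀ i j, i ≠ j → Tendsto
      (fun δ => ρ δ ^ 2 * criticalCorr d 2 ![latticeApprox δ (x i), latticeApprox δ (x j)])
      (𝓝[>] 0) (𝓝 (S 2 ![x i, x j])) := by
    intro i j hij
    have hmem : (![x i, x j] : Fin 2 → EuclideanSpace ℝ (Fin d)) ∈ NonCoincident d 2 :=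
      pair_mem_nonCoincident fun h => hij (hinj h)
    refine Tendsto.congr (fun δ => ?_) ((hlim 2).tendsto_at hmem)
    rw [rescaledCorrelator_apply, latticeApprox_comp_two]
    rfl
  have hU_tendsto : Tendsto U (𝓝[>] 0) (𝓝 (limitConnectedFour S x)) := by
    have h4 : Tendsto (fun δ => ρ δ ^ 4 * criticalCorr d 4 (fun i => latticeApprox δ (x i)))
        (𝓝[>] 0) (𝓝 (S 4 x)) := (hlim 4).tendsto_at hx
    have h := h4.sub ((((hpair 0 1 (by decide)).mul (hpair 2 3 (by decide))).add
      ((hpair 0 2 (by decide)).mul (hpair 1 3 (by decide)))).add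
      ((hpair 0 3 (by decide)).mul (hpair 1 2 (by decide))))
    have hlim_eq : limitConnectedFour S x = S 4 x - (S 2 ![x 0, x 1] * S 2 ![x 2, x 3]
        + S 2 ![x 0, x 2] * S 2 ![x 1, x 3] + S 2 ![x 0, x 3] * S 2 ![x 1, x 2]) := rfl
    rw [hlim_eq]
    refine Tendsto.congr (fun δ => ?_) h
    simp only [hU]
    ring
  /- Step 2: constants and the compact family of pair configurations. All scalar constants
  are introduced as opaque variables with defining equations (never as local definitions), so
  that no defeq check unfolds them. -/
  set x' : Fin 4 → (Fin d → ℝ) := fun i => WithLp.ofLp (x i) with hx'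
  have hx'inj : ∀ i j, i ≠ j → x' i ≠ x' j := fun i j hij h =>
    hij (hinj ((WithLp.ofLp_injective 2) h))
  set prs : Finset (Fin 4 × Fin 4) := Finset.univ.filter (fun q => q.1 ≠ q.2) with hprs
  have h01 : ((0 : Fin 4), (1 : Fin 4)) ∈ prs := Finset.mem_filter.2 ⟨Finset.mem_univ _, by decide⟩
  obtain ⟨r₀, hr₀⟩ : ∃ r : ℝ, r = prs.inf' ⟨_, h01⟩ (fun q => ‖x' q.1 - x' q.2‖) := ⟨_, rfl⟩
  have hr₀le : ∀ i j, i ≠ j → r₀ ≤ ‖x' i - x' j‖ := fun i j hij => by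
    rw [hr₀]
    exact Finset.inf'_le (fun q : Fin 4 × Fin 4 => ‖x' q.1 - x' q.2‖)
      (Finset.mem_filter.2 ⟨Finset.mem_univ (i, j), hij⟩)
  have hr₀pos : 0 < r₀ := by
    rw [hr₀, Finset.lt_inf'_iff]
    intro q hq
    exact norm_pos_iff.2 (sub_ne_zero.2 (hx'inj q.1 q.2 (Finset.mem_filter.1 hq).2))
  obtain ⟨a, ha⟩ : ∃ a : ℝ, a = r₀ / 4 := ⟨_, rfl⟩
  have ha0 : 0 < a := by rw [ha]; positivity
  -- the reference point `p₀ = e₁` and the far radius `B`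
  set k₀ : Fin d := ⟨0, hd1⟩ with hk₀
  set p₀ : EuclideanSpace ℝ (Fin d) := WithLp.toLp 2 (Pi.single k₀ (1 : ℝ)) with hp₀
  have hp₀ne : p₀ ≠ 0 := by
    intro h
    have h1 : (WithLp.ofLp p₀) k₀ = 0 := by rw [h]; rfl
    simp [hp₀] at h1
  have hp₀norm : ‖WithLp.ofLp p₀‖ ≤ 1 := by
    rw [pi_norm_le_iff_of_nonneg zero_le_one]
    intro k
    simp only [hp₀, WithLp.ofLp_toLp]
    by_cases hk : k = k₀
    · subst hk; simp
    · simp [Pi.single_eq_of_ne hk]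
  obtain ⟨X, hX⟩ : ∃ X : ℝ, X = ∑ i, ‖x' i‖ := ⟨_, rfl⟩
  have hX0 : 0 ≤ X := by rw [hX]; exact Finset.sum_nonneg fun i _ => norm_nonneg _
  have hXi : ∀ i, ‖x' i‖ ≤ X := fun i => by
    rw [hX]
    exact Finset.single_le_sum (f := fun i => ‖x' i‖) (fun i _ => norm_nonneg _) (Finset.mem_univ i)
  obtain ⟨B, hB⟩ : ∃ B : ℝ, B = 2 * X + 4 * d + 4 := ⟨_, rfl⟩
  have hB4 : 4 ≤ B := by
    have : (0 : ℝ) ≤ d := Nat.cast_nonneg d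
    rw [hB]; linarith
  have hB0 : 0 < B := by linarith
  -- the compact set of pair configurations
  set ΨA : Fin 4 → Fin 4 → (Fin d → ℝ) → (Fin 2 → EuclideanSpace ℝ (Fin d)) :=
    fun i j w => ![x j, x i + WithLp.toLp 2 w] with hΨA
  set ΨB : Fin 4 → (Fin d → ℝ) → (Fin 2 → EuclideanSpace ℝ (Fin d)) :=
    fun i w => ![x i, (0 : EuclideanSpace ℝ (Fin d)) + WithLp.toLp 2 w] with hΨB
  set KA : Set (Fin 2 → EuclideanSpace ℝ (Fin d)) :=
    ⋃ i, ⋃ j, ⋃ (_ : i ≠ j), ΨA i j '' Metric.closedBall 0 (2 * a) with hKA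
  set KB : Set (Fin 2 → EuclideanSpace ℝ (Fin d)) :=
    ⋃ i, ΨB i '' (Metric.closedBall 0 (B + 1) ∩ {w | a / 2 ≤ ‖w - x' i‖}) with hKB
  set K : Set (Fin 2 → EuclideanSpace ℝ (Fin d)) :=
    KA ∪ KB ∪ {![(0 : EuclideanSpace ℝ (Fin d)), p₀]} with hK
  have hKc : IsCompact K := by
    refine (IsCompact.union ?_ ?_).union isCompact_singleton
    · refine isCompact_iUnion fun i => isCompact_iUnion fun j => isCompact_iUnion fun _ => ?_
      exact (isCompact_closedBall _ _).image (continuous_pair_add_toLp _ _)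
    · refine isCompact_iUnion fun i => ?_
      refine ((isCompact_closedBall _ _).inter_right ?_).image (continuous_pair_add_toLp _ _)
      exact isClosed_le continuous_const ((continuous_id.sub continuous_const).norm)
  have hKs : K ⊆ NonCoincident d 2 := by
    intro z hz
    rcases hz with (hz | hz) | hz
    · simp only [hKA, Set.mem_iUnion, Set.mem_image] at hz
      obtain ⟨i, j, hij, w, hw, rfl⟩ := hz
      refine pair_mem_nonCoincident fun h => ?_
      have h' : x' j - x' i = w := by
        have h2 := congrArg WithLp.ofLp h
        simp only [WithLp.ofLp_add] at h2
        simp only [hx']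
        rw [h2, add_sub_cancel_left]
      have h1 := hr₀le j i (Ne.symm hij)
      rw [h'] at h1
      have h2 : ‖w‖ ≤ 2 * a := mem_closedBall_zero_iff.1 hw
      linarith
    · simp only [hKB, Set.mem_iUnion, Set.mem_image] at hz
      obtain ⟨i, w, ⟨-, hw2⟩, rfl⟩ := hz
      refine pair_mem_nonCoincident fun h => ?_
      have h' : w - x' i = 0 := by
        have h2 := congrArg WithLp.ofLp h
        simp only [WithLp.ofLp_toLp, zero_add] at h2
        simp only [hx']
        rw [h2, sub_self]
      have h3 : a / 2 ≤ ‖w - x' i‖ := hw2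
      rw [h', norm_zero] at h3
      linarith
    · rw [Set.mem_singleton_iff] at hz
      subst hz
      exact pair_mem_nonCoincident (Ne.symm hp₀ne)
  /- Step 3: the inputs — uniform bounds on `K`, the lower bound on `ρ`, the infrared bound,
  summability, monotonicity. -/
  obtain ⟨M₀, hM₀⟩ := exists_eventually_rescaled_two_le hd3 hlim hKc hKs
  obtain ⟨M, hM⟩ : ∃ M : ℝ, M = max M₀ 0 := ⟨_, rfl⟩
  have hMnn : 0 ≤ M := by rw [hM]; exact le_max_right _ _
  have hM₀M : M₀ ≤ M := by rw [hM]; exact le_max_left _ _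
  have h01nc : (![x 0, x 1] : Fin 2 → EuclideanSpace ℝ (Fin d)) ∈ NonCoincident d 2 :=
    pair_mem_nonCoincident fun h => absurd (hinj h) (by decide)
  obtain ⟨K₁, hK₁⟩ := exists_eventually_inv_sq_rho_le hd3 hlim h01nc (hS₂ _ h01nc)
  obtain ⟨K₂, hK₂⟩ : ∃ K₂ : ℝ, K₂ = max K₁ 0 := ⟨_, rfl⟩
  have hK₂nn : 0 ≤ K₂ := by rw [hK₂]; exact le_max_right _ _
  have hK₁K₂ : K₁ ≤ K₂ := by rw [hK₂]; exact le_max_left _ _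
  obtain ⟨C, hC0, hIR⟩ := exists_criticalTwoPoint_le_inv_pow hd3
  have hsumT := summable_inv_pow_supNorm hd
  have hMMS : ∀ v w : Site d, d * Site.supNorm w ≤ Site.supNorm v →
      criticalTwoPoint d v ≤ criticalTwoPoint d w := fun v w h =>
    twoPointPlus_le_of_mul_supNorm_le (criticalBeta_nonneg d) h
  -- the majorant delivered by `sum_box_prod_four_le`
  obtain ⟨Bnd, hBnd⟩ : ∃ Bnd : ℝ → ℝ, Bnd = fun δ =>
      4 * ((M * (ρ δ ^ 2)⁻¹) ^ 3 * (1 + C * (2 * d * 3 ^ (d - 1) * ((⌊a / δ⌋₊ : ℝ) + 1) ^ 2)))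
      + (#(box d ⌊B / δ⌋₊) : ℝ) * (M * (ρ δ ^ 2)⁻¹) ^ 4
      + C ^ 2 * 4 ^ (d - 2) * (M * (ρ δ ^ 2)⁻¹) ^ 2 *
        ((∑' u : Site d, ((Site.supNorm u : ℝ) ^ (2 * d - 4))⁻¹)
          - ∑ u ∈ box d ⌊B / δ⌋₊, ((Site.supNorm u : ℝ) ^ (2 * d - 4))⁻¹) :=
    ⟨_, rfl⟩
  have hsmall : ∀ᶠ δ in 𝓝[>] (0 : ℝ), 0 < δ ∧ δ ≤ min (a / 2) 1 := by
    have h1 : ∀ᶠ δ in 𝓝[>] (0 : ℝ), δ < min (a / 2) 1 :=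
      (eventually_lt_nhds (by positivity)).filter_mono nhdsWithin_le_nhds
    filter_upwards [h1, (eventually_mem_nhdsWithin : ∀ᶠ δ in 𝓝[>] (0 : ℝ), δ ∈ Set.Ioi 0)]
      with δ h1 h2
    exact ⟨h2, h1.le⟩
  /- Step 4: the eventual bound `|U δ| ≤ ρ(δ)⁴ · 2 Bnd δ`. -/
  have hbound : ∀ᶠ δ in 𝓝[>] (0 : ℝ), |U δ| ≤ ρ δ ^ 4 * (2 * Bnd δ) := by
    filter_upwards [hM₀, hK₁, hsmall] with δ hMδ hKδ hδ'
    obtain ⟨hδ, hδle⟩ := hδ'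
    have hδa2 : δ ≤ a / 2 := hδle.trans (min_le_left _ _)
    have hδ1 : δ ≤ 1 := hδle.trans (min_le_right _ _)
    have hδa : δ ≤ a := by linarith
    have hρ2 : 0 < ρ δ ^ 2 := hKδ.1
    obtain ⟨m, hm⟩ : ∃ m : ℝ, m = M * (ρ δ ^ 2)⁻¹ := ⟨_, rfl⟩
    have hm0 : 0 ≤ m := by rw [hm]; exact mul_nonneg hMnn (inv_nonneg.2 hρ2.le)
    -- values of the two-point function read off the compact `K`
    have hGK : ∀ z ∈ K, criticalTwoPoint d (latticeApprox δ (z 1) - latticeApprox δ (z 0)) ≤ m := by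
      intro z hz
      have h := hMδ z hz
      rw [latticeApprox_comp_two, criticalCorr_two_pair] at h
      have h' := h.trans hM₀M
      calc criticalTwoPoint d (latticeApprox δ (z 1) - latticeApprox δ (z 0))
          = (ρ δ ^ 2)⁻¹ * (ρ δ ^ 2 *
              criticalTwoPoint d (latticeApprox δ (z 1) - latticeApprox δ (z 0))) := by
            rw [← mul_assoc, inv_mul_cancel₀ hρ2.ne', one_mul]
        _ ≤ (ρ δ ^ 2)⁻¹ * M := mul_le_mul_of_nonneg_left h' (inv_nonneg.2 hρ2.le)
        _ = m := by rw [hm, mul_comm]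
    -- (A): near a marked point, the other factors are `≤ m`
    have hA : ∀ i j, i ≠ j → ∀ u, Site.supNorm (u - latticeApprox δ (x i)) ≤ ⌊a / δ⌋₊ →
        criticalTwoPoint d (latticeApprox δ (x j) - u) ≤ m := by
      intro i j hij u hu
      set w : Fin d → ℝ := WithLp.ofLp (δ • siteVec u) - x' i with hw
      have hwn : ‖w‖ ≤ 2 * a := norm_rescaled_sub_le_of_supNorm_le hδ hδa (x i) u hu
      have hz : ΨA i j w ∈ K := by
        refine Or.inl (Or.inl ?_)
        simp only [hKA, Set.mem_iUnion, Set.mem_image]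
        exact ⟨i, j, hij, w, mem_closedBall_zero_iff.2 hwn, rfl⟩
      have h := hGK _ hz
      have e1 : ΨA i j w 1 = δ • siteVec u := by
        simp only [hΨA, Matrix.cons_val_one, Matrix.cons_val_zero]
        exact add_toLp_ofLp_sub _ _
      have e0 : ΨA i j w 0 = x j := by simp only [hΨA, Matrix.cons_val_zero]
      rw [e1, e0, latticeApprox_smul_siteVec hδ] at h
      rwa [criticalTwoPoint_sub_comm]
    -- (B): in the bulk, all factors are `≤ m`
    have hBr : ∀ u, Site.supNorm u ≤ ⌊B / δ⌋₊ →
        (∀ i, ⌊a / δ⌋₊ < Site.supNorm (u - latticeApprox δ (x i))) →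
        ∀ i, criticalTwoPoint d (latticeApprox δ (x i) - u) ≤ m := by
      intro u hu hfar i
      set w : Fin d → ℝ := WithLp.ofLp (δ • siteVec u) with hw
      have hw1 : ‖w‖ ≤ B + 1 :=
        (norm_rescaled_le_of_supNorm_le hδ hB0.le u hu).trans (by linarith)
      have hw2 : a / 2 ≤ ‖w - x' i‖ :=
        le_norm_rescaled_sub_of_lt_supNorm hd1 hδ hδa2 (x i) u (hfar i)
      have hz : ΨB i w ∈ K := by
        refine Or.inl (Or.inr ?_)
        simp only [hKB, Set.mem_iUnion, Set.mem_image]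
        exact ⟨i, w, ⟨mem_closedBall_zero_iff.2 hw1, hw2⟩, rfl⟩
      have h := hGK _ hz
      have e1 : ΨB i w 1 = δ • siteVec u := by
        simp only [hΨB, Matrix.cons_val_one, Matrix.cons_val_zero, zero_add]
        rfl
      have e0 : ΨB i w 0 = x i := by simp only [hΨB, Matrix.cons_val_zero]
      rw [e1, e0, latticeApprox_smul_siteVec hδ] at h
      rwa [criticalTwoPoint_sub_comm]
    -- the reference value `G([p₀/δ]) ≤ m`
    have hw0 : criticalTwoPoint d (latticeApprox δ p₀) ≤ m := by
      have hz : (![(0 : EuclideanSpace ℝ (Fin d)), p₀] : Fin 2 → _) ∈ K :=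
        Or.inr (Set.mem_singleton _)
      have h := hGK _ hz
      simp only [Matrix.cons_val_one, Matrix.cons_val_zero] at h
      have hz0 : latticeApprox δ (0 : EuclideanSpace ℝ (Fin d)) = 0 := by
        funext k
        simp [latticeApprox_apply]
      rwa [hz0, sub_zero] at h
    -- (C): geometry of the far region
    have hsupy : ∀ i, (Site.supNorm (latticeApprox δ (x i)) : ℝ) ≤ X / δ + 1 := fun i =>
      (supNorm_latticeApprox_le hδ (x i)).trans (by gcongr; exact hXi i)
    have hsupw : (Site.supNorm (latticeApprox δ p₀) : ℝ) ≤ 1 / δ + 1 :=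
      (supNorm_latticeApprox_le hδ p₀).trans (by gcongr)
    have hC2 : ∀ u, ⌊B / δ⌋₊ < Site.supNorm u → ∀ i,
        Site.supNorm u ≤ 2 * Site.supNorm (latticeApprox δ (x i) - u) := by
      intro u hu i
      have hfloorB : B / δ < (⌊B / δ⌋₊ : ℝ) + 1 := Nat.lt_floor_add_one _
      have hu' : (⌊B / δ⌋₊ : ℝ) + 1 ≤ Site.supNorm u := by exact_mod_cast hu
      have h2y : 2 * Site.supNorm (latticeApprox δ (x i)) ≤ Site.supNorm u := by
        have h : (2 : ℝ) * Site.supNorm (latticeApprox δ (x i)) ≤ Site.supNorm u := by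
          have h1 : (2 : ℝ) * (X / δ + 1) ≤ B / δ := by
            have e : 2 * (X / δ + 1) = (2 * X + 2 * δ) / δ := by field_simp
            rw [e]
            refine div_le_div_of_nonneg_right ?_ hδ.le
            have : (0 : ℝ) ≤ d := Nat.cast_nonneg d
            rw [hB]; linarith
          linarith [hsupy i]
        exact_mod_cast h
      have htri := Site.supNorm_le_supNorm_sub_add u (latticeApprox δ (x i))
      rw [Site.supNorm_sub_comm] at htri
      omega
    have hC1 : ∀ u, ⌊B / δ⌋₊ < Site.supNorm u → ∀ i,
        d * Site.supNorm (latticeApprox δ p₀) ≤ Site.supNorm (latticeApprox δ (x i) - u) := by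
      intro u hu i
      have hfloorB : B / δ < (⌊B / δ⌋₊ : ℝ) + 1 := Nat.lt_floor_add_one _
      have hu' : (⌊B / δ⌋₊ : ℝ) + 1 ≤ Site.supNorm u := by exact_mod_cast hu
      have h2' : (Site.supNorm u : ℝ) ≤ 2 * Site.supNorm (latticeApprox δ (x i) - u) := by
        exact_mod_cast hC2 u hu i
      have hd0 : (0 : ℝ) ≤ d := Nat.cast_nonneg d
      have h : (d : ℝ) * Site.supNorm (latticeApprox δ p₀) ≤
          Site.supNorm (latticeApprox δ (x i) - u) := by
        have h1 : (d : ℝ) * (1 / δ + 1) ≤ B / δ / 2 := by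
          rw [div_div, le_div_iff₀ (by positivity)]
          have e : (d : ℝ) * (1 / δ + 1) * (δ * 2) = 2 * d + 2 * d * δ := by
            field_simp
          rw [e, hB]
          have : (d : ℝ) * δ ≤ d := by nlinarith
          linarith
        calc (d : ℝ) * Site.supNorm (latticeApprox δ p₀) ≤ d * (1 / δ + 1) :=
              mul_le_mul_of_nonneg_left hsupw hd0
          _ ≤ B / δ / 2 := h1
          _ ≤ Site.supNorm u / 2 := by linarith
          _ ≤ Site.supNorm (latticeApprox δ (x i) - u) := by linarith
      exact_mod_cast h
    -- assembling the tree diagram bound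
    have hB' : ∀ L : ℕ, ∑ u ∈ box d L, ∏ j, criticalTwoPoint d (latticeApprox δ (x j) - u) ≤
        Bnd δ := by
      intro L
      have h := sum_box_prod_four_le hd3 (criticalTwoPoint_nonneg' (d := d))
        criticalTwoPoint_le_one' hC0 hIR hsumT (fun i => latticeApprox δ (x i)) ⌊a / δ⌋₊
        ⌊B / δ⌋₊ (latticeApprox δ p₀) hm0 hA hBr hw0 (fun v hv => hMMS v _ hv) hC1 hC2 L
      rw [hm] at h
      rw [hBnd]
      exact h
    have hU4 := abs_criticalU4_le hd3 (fun i => latticeApprox δ (x i)) hB'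
    simp only [hU]
    rw [abs_mul, abs_of_nonneg (by positivity : (0 : ℝ) ≤ ρ δ ^ 4)]
    exact mul_le_mul_of_nonneg_left hU4 (by positivity)
  /- Step 5: the majorant is `O(δ^{d-4}) + o(1)`. -/
  obtain ⟨c₁, hc₁⟩ : ∃ c : ℝ, c = 8 * M ^ 3 * K₂ := ⟨_, rfl⟩
  obtain ⟨c₂, hc₂⟩ : ∃ c : ℝ, c = 8 * M ^ 3 * K₂ * C * (2 * d * 3 ^ (d - 1)) * (4 * a ^ 2)
      + 2 * (3 * B) ^ d * M ^ 4 * K₂ ^ 2 := ⟨_, rfl⟩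
  obtain ⟨c₃, hc₃⟩ : ∃ c : ℝ, c = 2 * C ^ 2 * 4 ^ (d - 2) * M ^ 2 := ⟨_, rfl⟩
  obtain ⟨E, hE⟩ : ∃ E : ℝ → ℝ, E = fun δ => c₁ * δ ^ (d - 2) + c₂ * δ ^ (d - 4)
      + c₃ * ((∑' u : Site d, ((Site.supNorm u : ℝ) ^ (2 * d - 4))⁻¹)
          - ∑ u ∈ box d ⌊B / δ⌋₊, ((Site.supNorm u : ℝ) ^ (2 * d - 4))⁻¹) :=
    ⟨_, rfl⟩
  have hcmp : ∀ᶠ δ in 𝓝[>] (0 : ℝ), ρ δ ^ 4 * (2 * Bnd δ) ≤ E δ := by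
    filter_upwards [hK₁, hsmall] with δ hKδ hδ'
    obtain ⟨hδ, hδle⟩ := hδ'
    have hδa2 : δ ≤ a / 2 := hδle.trans (min_le_left _ _)
    have hδ1 : δ ≤ 1 := hδle.trans (min_le_right _ _)
    have hδa : δ ≤ a := by linarith
    have hρ2 : 0 < ρ δ ^ 2 := hKδ.1
    have hρne : ρ δ ≠ 0 := fun h => by rw [h] at hρ2; norm_num at hρ2
    obtain ⟨I, hI⟩ : ∃ I : ℝ, I = (ρ δ ^ 2)⁻¹ := ⟨_, rfl⟩
    have hI0 : 0 ≤ I := by rw [hI]; exact inv_nonneg.2 hρ2.le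
    have hIK : I ≤ K₂ * δ ^ (d - 2) := by
      rw [hI]
      exact hKδ.2.trans (mul_le_mul_of_nonneg_right hK₁K₂ (by positivity))
    have htail0 : 0 ≤ (∑' u : Site d, ((Site.supNorm u : ℝ) ^ (2 * d - 4))⁻¹)
        - ∑ u ∈ box d ⌊B / δ⌋₊, ((Site.supNorm u : ℝ) ^ (2 * d - 4))⁻¹ := by
      have h := sum_filter_lt_supNorm_le_tsum_sub (fun u => by positivity) hsumT 0 ⌊B / δ⌋₊
      exact (Finset.sum_nonneg fun u _ => by positivity).trans h
    generalize hTl : (∑' u : Site d, ((Site.supNorm u : ℝ) ^ (2 * d - 4))⁻¹)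
        - ∑ u ∈ box d ⌊B / δ⌋₊, ((Site.supNorm u : ℝ) ^ (2 * d - 4))⁻¹ = Tl at htail0
    -- the cardinality of the bulk box (generalised at once: its cast must stay opaque)
    have hbox : (#(box d ⌊B / δ⌋₊) : ℝ) ≤ (3 * B / δ) ^ d := by
      rw [card_box]
      push_cast
      refine pow_le_pow_left₀ (by positivity) ?_ _
      have h1 : (⌊B / δ⌋₊ : ℝ) ≤ B / δ := Nat.floor_le (by positivity)
      have h2 : (1 : ℝ) ≤ B / δ := by rw [le_div_iff₀ hδ, one_mul]; linarith
      have h3 : 3 * B / δ = 3 * (B / δ) := by ring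
      linarith
    generalize hNb : (#(box d ⌊B / δ⌋₊) : ℝ) = Nb at hbox
    -- expansion of `ρ⁴ · 2 Bnd`
    have hexp : ρ δ ^ 4 * (2 * Bnd δ) =
        8 * M ^ 3 * I * (1 + C * (2 * d * 3 ^ (d - 1) * ((⌊a / δ⌋₊ : ℝ) + 1) ^ 2))
        + 2 * Nb * M ^ 4 * I ^ 2 + c₃ * Tl := by
      rw [hBnd]
      simp only []
      rw [hNb, hTl, hc₃, hI]
      field_simp
      ring
    clear hNb
    -- term (i)
    have hnA : (⌊a / δ⌋₊ : ℝ) + 1 ≤ 2 * a / δ := by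
      have h1 : (⌊a / δ⌋₊ : ℝ) ≤ a / δ := Nat.floor_le (by positivity)
      have h2 : (1 : ℝ) ≤ a / δ := by rw [le_div_iff₀ hδ, one_mul]; exact hδa
      have h3 : 2 * a / δ = 2 * (a / δ) := by ring
      linarith
    have hd0 : (0 : ℝ) ≤ d := Nat.cast_nonneg d
    have hi : 8 * M ^ 3 * I * (1 + C * (2 * d * 3 ^ (d - 1) * ((⌊a / δ⌋₊ : ℝ) + 1) ^ 2)) ≤
        c₁ * δ ^ (d - 2) + 8 * M ^ 3 * K₂ * C * (2 * d * 3 ^ (d - 1)) * (4 * a ^ 2)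
          * δ ^ (d - 4) := by
      calc 8 * M ^ 3 * I * (1 + C * (2 * d * 3 ^ (d - 1) * ((⌊a / δ⌋₊ : ℝ) + 1) ^ 2))
          ≤ 8 * M ^ 3 * (K₂ * δ ^ (d - 2)) *
              (1 + C * (2 * d * 3 ^ (d - 1) * (2 * a / δ) ^ 2)) := by gcongr
        _ = c₁ * δ ^ (d - 2) + 8 * M ^ 3 * K₂ * C * (2 * d * 3 ^ (d - 1)) * (4 * a ^ 2)
              * δ ^ (d - 4) := by
          have e : δ ^ (d - 2) = δ ^ (d - 4) * δ ^ 2 := by rw [← pow_add]; congr 1; omega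
          rw [hc₁, e]
          field_simp
          ring
    -- term (ii)
    have hii : 2 * Nb * M ^ 4 * I ^ 2 ≤ 2 * (3 * B) ^ d * M ^ 4 * K₂ ^ 2 * δ ^ (d - 4) := by
      have s1 : 2 * Nb * M ^ 4 * I ^ 2 ≤ 2 * (3 * B / δ) ^ d * M ^ 4 * I ^ 2 :=
        mul_le_mul_of_nonneg_right (mul_le_mul_of_nonneg_right
          (mul_le_mul_of_nonneg_left hbox zero_le_two) (pow_nonneg hMnn 4)) (pow_nonneg hI0 2)
      have s2 : 2 * (3 * B / δ) ^ d * M ^ 4 * I ^ 2 ≤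
          2 * (3 * B / δ) ^ d * M ^ 4 * (K₂ * δ ^ (d - 2)) ^ 2 :=
        mul_le_mul_of_nonneg_left (pow_le_pow_left₀ hI0 hIK 2) (by positivity)
      have s3 : 2 * (3 * B / δ) ^ d * M ^ 4 * (K₂ * δ ^ (d - 2)) ^ 2 =
          2 * (3 * B) ^ d * M ^ 4 * K₂ ^ 2 * δ ^ (d - 4) := by
        have e : (δ ^ (d - 2)) ^ 2 = δ ^ (d - 4) * δ ^ d := by
          rw [← pow_mul, ← pow_add]; congr 1; omega
        have e' : (K₂ * δ ^ (d - 2)) ^ 2 = K₂ ^ 2 * (δ ^ (d - 4) * δ ^ d) := by rw [mul_pow, e]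
        have hδd : δ ^ d ≠ 0 := pow_ne_zero _ hδ.ne'
        rw [e', div_pow]
        field_simp
      linarith only [s1, s2, s3]
    calc ρ δ ^ 4 * (2 * Bnd δ) = _ := hexp
      _ ≤ c₁ * δ ^ (d - 2) + c₂ * δ ^ (d - 4) + c₃ * Tl := by
        rw [hc₂]
        linarith only [hi, hii]
      _ = E δ := by rw [hE, ← hTl]
  have hEt : Tendsto E (𝓝[>] 0) (𝓝 0) := by
    have t1 : Tendsto (fun δ : ℝ => c₁ * δ ^ (d - 2)) (𝓝[>] 0) (𝓝 0) := by
      refine tendsto_nhdsWithin_of_tendsto_nhds ?_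
      simpa [zero_pow (by omega : d - 2 ≠ 0)] using
        ((continuous_id.pow (d - 2)).const_mul c₁).tendsto (0 : ℝ)
    have t2 : Tendsto (fun δ : ℝ => c₂ * δ ^ (d - 4)) (𝓝[>] 0) (𝓝 0) := by
      refine tendsto_nhdsWithin_of_tendsto_nhds ?_
      simpa [zero_pow (by omega : d - 4 ≠ 0)] using
        ((continuous_id.pow (d - 4)).const_mul c₂).tendsto (0 : ℝ)
    have hdiv : Tendsto (fun δ : ℝ => B / δ) (𝓝[>] 0) atTop := by
      simp_rw [div_eq_mul_inv]
      exact tendsto_inv_nhdsGT_zero.const_mul_atTop hB0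
    have hfl : Tendsto (fun δ : ℝ => ⌊B / δ⌋₊) (𝓝[>] 0) atTop :=
      tendsto_nat_floor_atTop.comp hdiv
    have t3 : Tendsto (fun δ : ℝ => c₃ *
        ((∑' u : Site d, ((Site.supNorm u : ℝ) ^ (2 * d - 4))⁻¹)
          - ∑ u ∈ box d ⌊B / δ⌋₊, ((Site.supNorm u : ℝ) ^ (2 * d - 4))⁻¹))
        (𝓝[>] 0) (𝓝 0) := by
      simpa using ((tendsto_tsum_sub_sum_box_atTop hsumT).comp hfl).const_mul c₃
    rw [hE]
    simpa using (t1.add t2).add t3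
  have hU0 : Tendsto U (𝓝[>] 0) (𝓝 0) := by
    refine squeeze_zero_norm' ?_ hEt
    filter_upwards [hbound, hcmp] with δ h1 h2
    rw [Real.norm_eq_abs]
    exact h1.trans h2
  exact tendsto_nhds_unique hU_tendsto hU0

end Literature.Probability.LatticeModels
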